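import Summits.NavierStokesRegularity.NavierStokesRegularity.Theses.ExtremiserTransience
import Summits.NavierStokesRegularity.NavierStokesRegularity.Theorems.ExtremiserTransienceBangBangCoreDefs
import Summits.NavierStokesRegularity.NavierStokesRegularity.Theorems.ExtremiserTransienceZoneTransversalityDefs
import Summits.NavierStokesRegularity.NavierStokesRegularity.Theorems.ExtremiserTransienceKStarAttainedDensity
import Summits.NavierStokesRegularity.NavierStokesRegularity.Theorems.ExtremiserTransienceLocalMaximiserDefs
import Summits.NavierStokesRegularity.NavierStokesRegularity.Theorems.ExtremiserTransienceLocalMaximiserLimitDefs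
import Summits.NavierStokesRegularity.NavierStokesRegularity.Theorems.ExtremiserTransienceLocalMaximiserThickGoodCentre
import Summits.NavierStokesRegularity.NavierStokesRegularity.Theorems.ExtremiserTransienceLocalMaximiserExtraction
import HarnessLib

/-!
# LINE g9-1 «local maximiser» — ideator seat ns-idea-10 (generation 9, lens «rescuer»)

Crux of record: `NearExtremalTransience` ⟨stmt-NavierStokesRegularity-21883⟩ (workfile ACL); statement concluded
BY NAME: `Summit.NavierStokesRegularity.NavierStokesRegularity.Theses.ExtremiserTransience.NearExtremalTransiencePerFlow`
⟨stmt-26567⟩, the route's rank-2 load-bearing crux (`closes hT hC hII hA` consumes it as `hT`); 21883 implies it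
(`perFlow_of_uniform`).  NO SUMMIT IS PROVED BY A LINE.  `sorry` occurs only inside the five open `stub_*` theorems (L2, L3, L4t′ on the primary route two; L4t, L5 on route one); L1 (§3a), the
clash (§3b), the off-contact first/second order (§3c), L4e Euler–Lagrange (§3d) and both compositions are PROVED.  (Stub census of record since REV 3.8:
`sorry` exactly in L4t, `stub_escape`, `stub_companionHalf`, `stub_robustHalf`, L5; L1, L2, L3, L4e CLOSED; Cells, L4t′, L4 DERIVED.)

DEATH RESCUED (the lens): bangbang_core K3 (★) / K14 `stub_localBangBang` (REFUTED-misstated, crowd+dud witness):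
«slack cannot certify LOCAL statements — the defect ε·M√Z√W of a near-extremiser is GLOBAL»; wall E0 (crowds: the
efficiency `|J|/(M√Z√W)` is invariant under gluing far-apart copies, so near-maximising sequences are not tight).

THE DODGE, as an explicit crux chain:
* L1 `LocalSlack` — the LOCAL SLACK INEQUALITY.  For a `(κ⋆−ε)`-extremal admissible `v` and tests `φ₁,…,φ_k` with
  pairwise disjoint supports, each keeping the height `≤ M` on its own support, the increments of `J, Z, W` are
  additive over `i`; universality of `κ⋆` for `v + Σφᵢ` and CONCAVITY of `√(ZW)` (tangent plane = AM–GM) give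
  `Σᵢ gainᵢ ≤ ε·M·√Z·√W`, `gainᵢ = ΔJᵢ − (κ⋆M/2)(λ⁻¹ΔZᵢ + λΔWᵢ)`, `λ = √(Z/W)` (abstract engine PROVED: `lsi_abstract`).
  So the global defect is SHARED by all disjoint cells: budget-most cells of Taylor size are `o(1)`-LOCAL MAXIMISERS of
  the local functional `F̃ = J − (κ⋆/2)(λ⁻¹Z + λW)` — first AND higher order, every admissible local test, one dud
  allowed (the crowd+dud witness is consistent), no cut-offs of `v`, no share accounting, no tightness.
* L2 `ThickGoodCentre` — 27-colouring of a `4Rλ`-grid + thin-vorticity inefficiency (`∫_{|ω|<θ₀M/λ} ω·Sω ≤ θ₀M√Z√W`)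
  + weighted pigeonhole: a centre `x₀` with `‖curl v x₀‖ ≥ θ₀M/λ` all of whose admissible tests inside `B(x₀,Rλ)` gain
  `≤ η M³`, with `ε₀(A,R,η)` explicit.
* L3 `Extraction` — violator frame (landed: `IsViolator`, F1 `flowFilamentBudget` = Seregin's bounded scaled energy,
  KNSS zoom compactness, analyticity of ancient mild slices): the zoomed slices at good thick centres converge in
  `C^k_loc` to an ANALYTIC field `V`, `‖V‖ ≤ 1`, all derivatives bounded, LINEAR local energy growth
  `∫_{B(x,R)}‖V‖² ≤ A_E R`, non-zero curl, which is a LOCAL MAXIMISER: `locGain κ⋆ 1 V φ ≤ 0` for every smooth compactly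
  supported divergence-free ROBUST test `φ` (REV 3.0 `IsLocMaxIn`: pointwise slack `‖V+φ‖ ≤ 1−θ` or inward
  `‖φ‖²+2⟪V,φ⟫ ≤ −θ‖φ‖`; such tests are admissible for the whole tail of the zoom sequence and gains are integrals over
  `tsupport φ`, so maximality passes to the limit; strict tests are robust).
* L4 `HomogeneityClash` (THE HEART) — a local maximiser with bounded near-top components and NO speed plateau
  (`interior {‖V‖ = 1} = ∅`) has zero curl.  Engine (abstract form PROVED: `clash_abstract`): the Euler–Lagrange density
  of `F̃` is continuous and vanishes off the nowhere-dense contact set, hence everywhere (`E = ∇q`); the BLOB-RESPECTING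
  amplitude-lowering test `V ↦ V − s(χV + ∇χ × ψ)` (`χ` locally constant on every near-top component it meets, `ψ` the
  linear-growth vector potential, `|ψ| = O(log r)` on `B_{2r}`) is admissible for `s ∈ (0, η′/2]` uniformly; first order
  `3J_χ = 2K_χ + o`, second order `6J_{χ²} ≤ 2K_{χ²} + o` ⇒ `K_{χ²} = (κ⋆/2)∫χ²(|Ω|² + |∇Ω|²) ≤ o(bulk)` at
  doubling-regular radii — contradiction with `curl V ≠ 0`.  (3-vs-2: cubic `J` against quadratic `Z, W`.)
* L5 `NoPercolation` — near-top components `{‖V‖ > 1 − η′}` of such a `V` are uniformly bounded (the residual enemy: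
  a straight near-top TUBE; = filament_selection's tube slice, here additionally a local maximiser).
* plateau branch PROVED (`noPlateau_of_linearGrowth`): analytic + speed plateau ⇒ `‖V‖ ≡ 1` ⇒ cubic energy growth,
  contradicting the linear budget.
Composition `NearExtremalTransiencePerFlow_of` (§4) is kernel-checked from the five stubs; REV 1.1 adds the PARENT NODE
`Sig.LimitLiouville` (L4+L5 ⇒ it, `limitLiouville_of`) with the second composition `NearExtremalTransiencePerFlow_of_liouville`
(L1, L2, L3, LimitLiouville), weakens L5 to levels near the top, and records the transverse-corrector route in the card;
REV 1.2 PROVES L1 (`localSlack_holds`: germ-locality of `sd/zd/wd`, joint field admissible, `sharpDepletion_is_universal`, `lsi_abstract`);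
REV 2.0 DECOMPOSES THE HEART: cubic structure `locGain_smul` (proved), L4e `EulerLagrange` + L4t `AmplitudeTests` (typed interface
`HasAmplitudeTests`), and the clash `homogeneityClash_of : EulerLagrange → AmplitudeTests → HomogeneityClash` PROVED; open stubs L2 L3 L4e L4t L5;
REV 2.1 PROVES the easy half of L4e (§3c: two-sided tests off the contact set ⇒ `a₁ = 0 ∧ a₂ ≤ 0`; `eulerLagrange_dim`;
`clash_core`; `curl_eq_zero_of_dim` — the dim Liouville step needs only `HasAmplitudeTests`);
REV 3.0 UPGRADES THE TEST CLASS of the limit to ROBUST (inward-or-slack) tests `IsTestIn`/`IsLocMaxIn` — the widest class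
that passes to zoom limits; it admits amplitude tests touching contact curves along tubes — and types the SECOND ROUTE:
L4t′ `AmplitudeTestsTransverse` (no near-top geometry) with `limitLiouville_of_transverse` and
`NearExtremalTransiencePerFlow_of3 : L2 → L3 → L4e → L4t′ → crux` PROVED; and PROVES L4e `Sig.EulerLagrange`
(`eulerLagrange_holds`, §3d: `KStar.exists_density` + fundamental lemma + density of `{‖V‖ < 1}`); open stubs L2 L3 L4t L5 | L4t′.
REV 3.1 WEAKENS the interface `HasAmplitudeTests` to amplitudes `s ∈ (0,s₀]` (some `s₀ > 0`), PROVES the robust-limit engines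
(§2b `isTestIn_of_near`, `isLocMaxIn_of_limit`, `tendsto_locGain_of_dominated` — the maximality clause of L3), SLACK DENSITY
(§2c `exists_slack_near`, `slack_dense`: linear growth at every centre ⇒ no fat near-top regions) and the small-amplitude
admissibility criterion `isTestIn_smul_of_cone` (§3c), and redesigns route two on them (L4t′: recirculation cells through
dense slack; now the primary leaf); open stubs L2 L3 L4t′ | L4t L5.
REV 3.2a TYPES the residual of route two (§3f: `Sig.Escape` — no backward-cone traps under linear growth, kinematic, size M — and
`Sig.CellsGivenEscape`, with `amplitudeTestsTransverse_of` PROVED; L4t′ derived).  REV 3.2 uses the §1 texts and L1/L2/Selection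
statements OF RECORD landed by ns-net-p1 g14 (`Theorems/ExtremiserTransienceLocalMaximiserDefs.lean`, p709662) BY NAME — L2 closes by
the landed `thickGoodCentre_holds` (`…LocalMaximiserThickGoodCentre.lean`) as soon as that module is built on the farm — and PROVES
the PLATEAU CALCULUS (§3g `plateau_densities`, `a1_layer`, `a2_layer`: the two defects of `HasAmplitudeTests` are integrals over the
transition layer only); REV 3.3 uses the landed limit-class vocabulary + `Extraction` (ns-net-p2 g11, `…LocalMaximiserLimitDefs`) BY NAME, plugs the landed
`thickGoodCentre_holds` (p710316) into L2, and records the error budget of `CellsGivenEscape`; REV 3.4 PROVES the kinematic bricks of §2d (Lipschitz from the budget, slack balls, near-top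
volume is linear, the WALL LEMMA = polar of the backward cone, doubling scale) and of §3f (straight escape segments, `not_hasEscape_const` = growth is
load-bearing, `amplitude_clause`, `cone_add`), REV 3.5 CLOSES L2 BY NAME (`stub_thickGoodCentre := thickGoodCentre_holds`, sorries 6 → 5), and REV 3.6 CUTS
`CellsGivenEscape` IN TWO (§3i: `Sig.CompanionHalf` — analytic, size M, scale-regular radius + L² layer budget, no cells — and `Sig.RobustHalf` — the
cells, size L — at the CANONICAL cut-off `cut y r`; `cellsGivenEscape_of_halves` PROVED, so `stub_cellsGivenEscape` is DERIVED; bricks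
`exists_twoScale_radius`, `exists_cutoff`), and REV 3.7 PROVES `exists_scaleRegular` (scale-regular radii exist beyond every threshold for
limit-class fields at a point of non-zero curl: `zd_add_wd_le` + `bulk_le_of_budget` + `bulk_pos` + `exists_twoScale_radius16`) — the radius half of
`CompanionHalf` is discharged; open stubs L3(→ `extraction_holds` when landed) Escape CompanionHalf RobustHalf | L4t L5 (sorries 6).

Card: `Cruxes/NearExtremalTransience/Lines/local_maximiser.md`.  Idea: `Cruxes/NearExtremalTransience/Ideas/local-maximiser.md`.
-/

noncomputable section

open scoped Topology InnerProductSpace RealInnerProductSpace ENNReal ContDiff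
open MeasureTheory Filter Set
open Literature.Analysis.FluidPDE
open Summit.NavierStokesRegularity.NavierStokesRegularity.Theses.ExtremiserTransience
open Summit.NavierStokesRegularity.NavierStokesRegularity.Theorems.DepletionLadder.KStar.HalfSpace
open Summit.NavierStokesRegularity.NavierStokesRegularity.Theorems.DepletionLadder.KStar.BangBang
open Summit.NavierStokesRegularity.NavierStokesRegularity.Theorems.NearExtremalTransiencePerFlow.ZoneTransversality

namespace Summit.NavierStokesRegularity.NavierStokesRegularity.Cruxes.NearExtremalTransience.LocalMaximiser

set_option linter.dupNamespace false
set_option linter.unusedVariables false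

/-! ## §1 Vocabulary: densities, local gain, admissible local tests, local maximisers -/

/- REV 3.2: the §1 texts `sd zd wd locGain IsTestAt` and the statements `LocalSlack`, `ThickGoodCentre`, `Selection` are now the
TEXTS OF RECORD landed by ns-net-p1 g14 in `Theorems/ExtremiserTransienceLocalMaximiserDefs.lean` (p709662; verbatim this line's REV ≤ 3.1 §1),
namespace `Summit.NavierStokesRegularity.NavierStokesRegularity.Theorems.NearExtremalTransiencePerFlow.LocalMaximiser`; the line uses them BY NAME (no local copies), so
`stub_thickGoodCentre` closes by the landed `thickGoodCentre_holds`.  REV 3.3: likewise the limit-class vocabulary `IsTest IsLocMax IsTestIn IsLocMaxIn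
HasLinearGrowth NearTopBounded InLimitClass` and the statement `Extraction` are the texts of record landed by ns-net-p2 g11 in
`Theorems/ExtremiserTransienceLocalMaximiserLimitDefs.lean` (verbatim this line's REV 3.0 texts), used BY NAME; the docstrings of REV ≤ 3.2 for these
notions (why the ROBUST class, why linear growth) are kept in the card. -/
open Summit.NavierStokesRegularity.NavierStokesRegularity.Theorems.NearExtremalTransiencePerFlow.LocalMaximiser (sd zd wd locGain IsTestAt thickGoodCentre_holds
  IsTest IsLocMax IsTestIn IsLocMaxIn HasLinearGrowth NearTopBounded InLimitClass)

/-! ## §2 Two abstract engines, PROVED -/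

/-- **LSI ENGINE (tangent plane of the concave `√(ZW)` = AM–GM).** With `u = √Z`, `w = √W`, `p = √Z'`, `q = √W'`
(perturbed budgets), universality `J' ≤ κM·p·q` and near-extremality `(κ−ε)M·u·w ≤ J` give
`J' − J − (κM/2)((w/u)(p²−u²) + (u/w)(q²−w²)) ≤ εM·u·w`; note `w/u = λ⁻¹`, `u/w = λ`. [folklore] -/
theorem lsi_abstract {u w p q J J' κ M ε : ℝ} (hu : 0 < u) (hw : 0 < w) (hp : 0 ≤ p) (hq : 0 ≤ q)
    (hκM : 0 ≤ κ * M) (huniv : J' ≤ κ * M * p * q) (hext : (κ - ε) * M * u * w ≤ J) :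
    J' - J - κ * M / 2 * ((w / u) * (p ^ 2 - u ^ 2) + (u / w) * (q ^ 2 - w ^ 2)) ≤ ε * M * u * w := by
  have huw : 0 < u * w := mul_pos hu hw
  -- AM–GM: `2uw·pq ≤ w²p² + u²q²`
  have hamgm : κ * M * (2 * (u * w) * (p * q)) ≤ κ * M * (w ^ 2 * p ^ 2 + u ^ 2 * q ^ 2) :=
    mul_le_mul_of_nonneg_left (by nlinarith [sq_nonneg (w * p - u * q)]) hκM
  have hrew : (w / u) * (p ^ 2 - u ^ 2) + (u / w) * (q ^ 2 - w ^ 2) =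
      (w ^ 2 * p ^ 2 + u ^ 2 * q ^ 2 - 2 * (u * w) * (u * w)) / (u * w) := by
    field_simp
    ring
  rw [hrew]
  have key : κ * M / 2 * ((w ^ 2 * p ^ 2 + u ^ 2 * q ^ 2 - 2 * (u * w) * (u * w)) / (u * w)) ≥
      κ * M * (p * q) - κ * M * (u * w) := by
    rw [ge_iff_le, ← sub_nonneg]
    have h1 : κ * M / 2 * ((w ^ 2 * p ^ 2 + u ^ 2 * q ^ 2 - 2 * (u * w) * (u * w)) / (u * w)) -
        (κ * M * (p * q) - κ * M * (u * w)) =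
        (κ * M * (w ^ 2 * p ^ 2 + u ^ 2 * q ^ 2) - κ * M * (2 * (u * w) * (p * q))) / (2 * (u * w)) := by
      field_simp
      ring
    rw [h1]
    exact div_nonneg (by linarith) (by positivity)
  have hJ' : J' ≤ κ * M * (p * q) := by linarith [huniv, show κ * M * p * q = κ * M * (p * q) by ring]
  have hJ : κ * M * (u * w) - ε * M * u * w ≤ J := by nlinarith [hext]
  linarith

/-- **CLASH ENGINE (3-vs-2 homogeneity).** If the first variation along the amplitude test vanishes up to `e₁`
(`3J − 2K = e₁`) and the second variation is `≤ e₂` (`6J − 2K ≤ e₂`), then the positive bulk `K` is `≤ e₂/2 − e₁`: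
an Euler–Lagrange-critical configuration is a local MINIMUM along amplitude-lowering unless it carries no budget. [folklore] -/
theorem clash_abstract {J K e₁ e₂ : ℝ} (h1 : 3 * J - 2 * K = e₁) (h2 : 6 * J - 2 * K ≤ e₂) :
    K ≤ e₂ / 2 - e₁ := by linarith

/-- **PLATEAU BRANCH, PROVED.** An analytic field with a speed plateau (`‖V‖ = 1` on a non-empty open set) has `‖V‖ ≡ 1`,
hence cubic local energy growth — incompatible with linear growth. [folklore] -/
theorem noPlateau_of_linearGrowth {V : E3 → E3} {A_E : ℝ} (han : AnalyticOnNhd ℝ V univ)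
    (hgr : HasLinearGrowth A_E V) (hpl : (interior {x : E3 | ‖V x‖ = 1}).Nonempty) : False := by
  obtain ⟨x₀, hx₀⟩ := hpl
  -- `‖V‖² = Σᵢ Vᵢ²` is analytic
  have hsq : AnalyticOnNhd ℝ (fun x => ‖V x‖ ^ 2) univ := by
    have hcoord : ∀ i : Fin 3, AnalyticOnNhd ℝ (fun x => V x i) univ := fun i =>
      (EuclideanSpace.proj i : EuclideanSpace ℝ (Fin 3) →L[ℝ] ℝ).comp_analyticOnNhd han
    have heq : (fun x => ‖V x‖ ^ 2) = fun x => ∑ i, V x i * V x i := by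
      funext x
      rw [EuclideanSpace.norm_eq, Real.sq_sqrt (Finset.sum_nonneg fun i _ => sq_nonneg _)]
      exact Finset.sum_congr rfl fun i _ => by rw [Real.norm_eq_abs, sq_abs, sq]
    rw [heq]
    exact Finset.analyticOnNhd_fun_sum _ fun i _ => (hcoord i).mul (hcoord i)
  have hev : (fun x => ‖V x‖ ^ 2) =ᶠ[𝓝 x₀] fun _ => (1 : ℝ) := by
    filter_upwards [mem_interior_iff_mem_nhds.1 hx₀] with x hx
    have hx' : ‖V x‖ = 1 := hx
    rw [hx', one_pow]
  have hconst : (fun x => ‖V x‖ ^ 2) = fun _ => (1 : ℝ) := hsq.eq_of_eventuallyEq analyticOnNhd_const hev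
  have hone : ∀ x, ‖V x‖ ^ 2 = 1 := fun x => congrFun hconst x
  -- the unit ball has positive finite volume `b`; `vol B(0,R) = R³ b`
  set b : ℝ := (volume (Metric.ball (0 : E3) 1)).toReal with hb
  have hbpos : 0 < b := by
    rw [hb]
    refine ENNReal.toReal_pos (Metric.measure_ball_pos volume (0 : E3) one_pos).ne' measure_ball_lt_top.ne
  have hvolR : ∀ R : ℝ, 0 < R → (volume (Metric.ball (0 : E3) R)).toReal = R ^ 3 * b := by
    intro R hR
    rw [Measure.addHaar_ball_of_pos volume (0 : E3) hR, ENNReal.toReal_mul, finrank_euclideanSpace,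
      Fintype.card_fin, ENNReal.toReal_ofReal (by positivity), hb]
  -- energy of `B(0,R)` equals its volume
  have hener : ∀ R : ℝ, 0 < R → ∫ y in Metric.ball (0 : E3) R, ‖V y‖ ^ 2 = R ^ 3 * b := by
    intro R hR
    rw [← hvolR R hR]
    simp_rw [hone]
    rw [setIntegral_const, smul_eq_mul, mul_one]
    rfl
  -- take `R` with `R² b > A_E`
  have hAE : 0 ≤ A_E := by
    have h := hgr 0 1 one_pos
    rw [hener 1 one_pos] at h
    nlinarith
  set R : ℝ := Real.sqrt (A_E / b) + 1 with hR
  have hRpos : 0 < R := by rw [hR]; positivity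
  have hge : Real.sqrt (A_E / b) ^ 2 = A_E / b := Real.sq_sqrt (div_nonneg hAE hbpos.le)
  have hmain := hgr 0 R hRpos
  rw [hener R hRpos] at hmain
  -- `R³ b ≤ A_E R` contradicts `R² b > A_E`
  have hR2 : A_E < R ^ 2 * b := by
    have : A_E = (A_E / b) * b := by field_simp
    rw [this, ← hge]
    have hs : 0 ≤ Real.sqrt (A_E / b) := Real.sqrt_nonneg _
    have hlt : Real.sqrt (A_E / b) ^ 2 < R ^ 2 := by
      rw [hR]; nlinarith
    exact mul_lt_mul_of_pos_right hlt hbpos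
  have : R ^ 3 * b = R * (R ^ 2 * b) := by ring
  rw [this] at hmain
  have h2 : R * (R ^ 2 * b) > R * A_E := mul_lt_mul_of_pos_left hR2 hRpos
  linarith

/-! ## §2b  ROBUST TESTS PASS TO LIMITS (PROVED, REV 3.0) — the reason for the class `IsTestIn` / `IsLocMaxIn`

A robust test of margin `θ` for `V` is a robust test of margin `θ/2` for every field `θ/4`-close to `V` in `C⁰(tsupport φ)`
(`isTestIn_of_near`); hence if the `v n` converge to `V` uniformly on compacts, their local gains converge, and each `v n`
gains at most `ε n → 0` on robust tests, then `V` is a robust local maximiser (`isLocMaxIn_of_limit`).  This is the abstract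
engine behind the maximality clause of L3 `Extraction` (whose prover supplies the convergence of gains from `C²_loc`
compactness and the almost-maximality from L1 + the selection L2). -/

section RobustLimit

variable {κ μ : ℝ}

/-- Robust tests are stable under `C⁰(tsupport φ)`-perturbation of the base field, with half the margin. [folklore] -/
theorem isTestIn_of_near {V V' φ : E3 → E3} {θ : ℝ} (hθ : 0 ≤ θ) (h : IsTestIn V θ φ)
    (hnear : ∀ x ∈ tsupport φ, ‖V' x - V x‖ ≤ θ / 4) : IsTestIn V' (θ / 2) φ := by
  obtain ⟨hφs, hφc, hφdiv, hpt⟩ := h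
  refine ⟨hφs, hφc, hφdiv, fun x => ?_⟩
  by_cases hx : x ∈ tsupport φ
  · have hd := hnear x hx
    rcases hpt x with h1 | h2
    · left
      calc ‖V' x + φ x‖ = ‖(V x + φ x) + (V' x - V x)‖ := by congr 1; abel
        _ ≤ ‖V x + φ x‖ + ‖V' x - V x‖ := norm_add_le _ _
        _ ≤ 1 - θ / 2 := by linarith
    · right
      have hcs : ⟪V' x - V x, φ x⟫_ℝ ≤ ‖V' x - V x‖ * ‖φ x‖ := real_inner_le_norm _ _
      have hsplit : ⟪V' x, φ x⟫_ℝ = ⟪V x, φ x⟫_ℝ + ⟪V' x - V x, φ x⟫_ℝ := by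
        rw [← inner_add_left]; congr 1; abel
      have hφ0 : 0 ≤ ‖φ x‖ := norm_nonneg _
      nlinarith
  · right
    have h0 : φ x = 0 := image_eq_zero_of_notMem_tsupport hx
    simp [h0]

/-- **Robust local maximality passes to the limit.**  If `v n → V` uniformly on compact sets (tested on supports), the
local gains converge, and `v n` gains at most `ε n → 0` on every robust test, then `V` is a robust local maximiser.
[folklore] -/
theorem isLocMaxIn_of_limit {V : E3 → E3} {v : ℕ → E3 → E3} {ε : ℕ → ℝ} (hε : Tendsto ε atTop (𝓝 0))
    (hnear : ∀ φ : E3 → E3, HasCompactSupport φ → ∀ δ : ℝ, 0 < δ →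
      ∀ᶠ n in atTop, ∀ x ∈ tsupport φ, ‖v n x - V x‖ ≤ δ)
    (hgain : ∀ φ : E3 → E3, ContDiff ℝ (⊤ : ℕ∞) φ → HasCompactSupport φ →
      Tendsto (fun n => locGain κ μ (v n) φ) atTop (𝓝 (locGain κ μ V φ)))
    (hmax : ∀ (n : ℕ) (θ : ℝ) (φ : E3 → E3), 0 < θ → IsTestIn (v n) θ φ → locGain κ μ (v n) φ ≤ ε n) :
    IsLocMaxIn κ μ V := by
  intro θ φ hθ hφ
  have hev : ∀ᶠ n in atTop, locGain κ μ (v n) φ ≤ ε n := by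
    filter_upwards [hnear φ hφ.2.1 (θ / 4) (by positivity)] with n hn
    exact hmax n (θ / 2) φ (by positivity) (isTestIn_of_near hθ.le hφ hn)
  exact le_of_tendsto_of_tendsto (hgain φ hφ.1 hφ.2.1) hε hev

end RobustLimit

/-! ## §2c  SLACK IS DENSE (PROVED, REV 3.1) — fat near-top regions are impossible under linear energy growth

If `‖V‖ > 1 − η` on a whole ball `B(z,ρ)` then `∫_{B(z,ρ)} ‖V‖² ≥ (1−η)²·ρ³·|B₁|`, so linear growth `≤ A_E·ρ` (which holds at
EVERY centre) caps `ρ`.  Hence every ball of the fixed radius `D(A_E, η)` contains a point of speed `≤ 1 − η`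
(`exists_slack_near`, `slack_dense`): slack regions — where a robust test may point in ANY direction — are uniformly dense in
space, and near-top structures have in-radius `< D`.  This is the geometric input of the route-two construction of amplitude
tests (L4t′, card §Transverse corrector): near-top structures crossing the cut-off shell have in-radius `≤ D ≪ w`, so the
divergence corrector can recirculate through adjacent slack. -/

section SlackDensity

/-- Volume of a ball of `E3` in terms of the unit ball. [folklore] -/
theorem volume_ball_toReal (z : E3) {ρ : ℝ} (hρ : 0 < ρ) :
    (volume (Metric.ball z ρ)).toReal = ρ ^ 3 * (volume (Metric.ball (0 : E3) 1)).toReal := by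
  rw [Measure.addHaar_ball_of_pos volume z hρ, ENNReal.toReal_mul, finrank_euclideanSpace, Fintype.card_fin,
    ENNReal.toReal_ofReal (by positivity)]

/-- The unit ball of `E3` has positive (finite) volume. [folklore] -/
theorem volume_unitBall_toReal_pos : 0 < (volume (Metric.ball (0 : E3) 1)).toReal :=
  ENNReal.toReal_pos (Metric.measure_ball_pos volume (0 : E3) one_pos).ne' measure_ball_lt_top.ne

/-- **NO FAT NEAR-TOP BALLS (PROVED).**  For continuous `V` with linear energy growth `A_E`, a ball `B(z,ρ)` with
`(1−η)²·ρ²·|B₁| > A_E` contains a point of speed `≤ 1 − η`. -/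
theorem exists_slack_near {A_E : ℝ} {V : E3 → E3} (hV : Continuous V) (hG : HasLinearGrowth A_E V) {η : ℝ}
    (hη1 : η ≤ 1) (z : E3) {ρ : ℝ} (hρ : 0 < ρ)
    (hbig : A_E < (1 - η) ^ 2 * ρ ^ 2 * (volume (Metric.ball (0 : E3) 1)).toReal) :
    ∃ x ∈ Metric.ball z ρ, ‖V x‖ ≤ 1 - η := by
  by_contra h
  push Not at h
  set b : ℝ := (volume (Metric.ball (0 : E3) 1)).toReal with hb
  have hint : IntegrableOn (fun x => ‖V x‖ ^ 2) (Metric.ball z ρ) volume :=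
    ((hV.norm.pow 2).continuousOn.integrableOn_compact (isCompact_closedBall z ρ)).mono_set Metric.ball_subset_closedBall
  have hlow : ∫ x in Metric.ball z ρ, (1 - η) ^ 2 ≤ ∫ x in Metric.ball z ρ, ‖V x‖ ^ 2 := by
    refine setIntegral_mono_on (integrableOn_const measure_ball_lt_top.ne) hint measurableSet_ball fun x hx => ?_
    have h1 : 1 - η < ‖V x‖ := h x hx
    have h0 : 0 ≤ 1 - η := by linarith
    nlinarith
  have hconst : ∫ x in Metric.ball z ρ, (1 - η) ^ 2 = ρ ^ 3 * b * (1 - η) ^ 2 := by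
    rw [setIntegral_const, smul_eq_mul, measureReal_def, volume_ball_toReal z hρ]
  rw [hconst] at hlow
  have hup : ∫ x in Metric.ball z ρ, ‖V x‖ ^ 2 ≤ A_E * ρ := hG z ρ hρ
  have hchain : ρ * ((1 - η) ^ 2 * ρ ^ 2 * b) ≤ ρ * A_E := by nlinarith [hlow, hup]
  have := le_of_mul_le_mul_left hchain hρ
  linarith

/-- **SLACK IS `D`-DENSE (PROVED).**  For continuous `V` with linear energy growth there is, for every level `η ≤ 1`, a
radius `D > 0` such that EVERY ball of radius `D` contains a point of speed `≤ 1 − η`; equivalently no ball of radius `D`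
lies inside the near-top set `{‖V‖ > 1 − η}`. -/
theorem slack_dense {A_E : ℝ} {V : E3 → E3} (hV : Continuous V) (hG : HasLinearGrowth A_E V) {η : ℝ} (hη : η < 1) :
    ∃ D : ℝ, 0 < D ∧ ∀ z : E3, ∃ x ∈ Metric.ball z D, ‖V x‖ ≤ 1 - η := by
  set b : ℝ := (volume (Metric.ball (0 : E3) 1)).toReal with hb
  have hbpos : 0 < b := volume_unitBall_toReal_pos
  have hc : 0 < (1 - η) ^ 2 * b := mul_pos (by nlinarith) hbpos
  set D : ℝ := max 1 ((|A_E| + 1) / ((1 - η) ^ 2 * b)) with hD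
  have hD1 : 1 ≤ D := le_max_left _ _
  have hDpos : 0 < D := by linarith
  refine ⟨D, hDpos, fun z => exists_slack_near hV hG hη.le z hDpos ?_⟩
  have hD2 : (|A_E| + 1) / ((1 - η) ^ 2 * b) ≤ D := le_max_right _ _
  have h3 : |A_E| + 1 ≤ D * ((1 - η) ^ 2 * b) := by rwa [div_le_iff₀ hc] at hD2
  have hDD : D ≤ D ^ 2 := by nlinarith [hD1]
  have h4 : D * ((1 - η) ^ 2 * b) ≤ (1 - η) ^ 2 * D ^ 2 * b :=
    calc D * ((1 - η) ^ 2 * b) ≤ D ^ 2 * ((1 - η) ^ 2 * b) := mul_le_mul_of_nonneg_right hDD hc.le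
      _ = (1 - η) ^ 2 * D ^ 2 * b := by ring
  have h5 : A_E ≤ |A_E| := le_abs_self _
  linarith

/-- In the limit class slack is dense at every level below the top (packaged for L4t′). -/
theorem slack_dense_of_inLimitClass {A : ℕ → ℝ} {A_E : ℝ} {V : E3 → E3} (hV : InLimitClass A A_E V) {η : ℝ} (hη : η < 1) :
    ∃ D : ℝ, 0 < D ∧ ∀ z : E3, ∃ x ∈ Metric.ball z D, ‖V x‖ ≤ 1 - η :=
  slack_dense hV.2.1.continuous hV.2.2.2.2.2.1 hη

end SlackDensity

/-! ## §2d  Kinematic bricks for `Escape` and the cells (PROVED): Lipschitz from the budget, slack BALLS, near-top volume is linear -/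
section KinematicBricks

/-- **LIPSCHITZ FROM THE BUDGET (PROVED).**  `‖V y − V x‖ ≤ A 1 · ‖y − x‖` (mean value inequality + `‖iteratedFDeriv 1‖ = ‖fderiv‖`). -/
theorem norm_sub_le_of_budget {A : ℕ → ℝ} {V : E3 → E3} (hV : ContDiff ℝ (⊤ : ℕ∞) V)
    (hA : ∀ (j : ℕ) (x : E3), ‖iteratedFDeriv ℝ j V x‖ ≤ A j) (x y : E3) : ‖V y - V x‖ ≤ A 1 * ‖y - x‖ := by
  have hVd : Differentiable ℝ V := hV.differentiable (by simp)
  refine Convex.norm_image_sub_le_of_norm_fderiv_le (fun z _ => hVd z) (fun z _ => ?_) convex_univ (Set.mem_univ x)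
    (Set.mem_univ y)
  rw [← norm_iteratedFDeriv_one]
  exact hA 1 z

/-- **SLACK BALLS (PROVED).**  Slack density (§2c) + the Lipschitz bound: for every level `0 < η < 1` there is `D > 0` such that
every ball of radius `D` contains the centre of a whole BALL of radius `η / (2 (A 1 + 1))` on which `‖V‖ ≤ 1 − η/2` — the
"turning rooms" of the recirculation cells and the targets of the escape paths. -/
theorem exists_slack_ball {A : ℕ → ℝ} {A_E : ℝ} {V : E3 → E3} (hV : ContDiff ℝ (⊤ : ℕ∞) V)
    (hA : ∀ (j : ℕ) (x : E3), ‖iteratedFDeriv ℝ j V x‖ ≤ A j) (hG : HasLinearGrowth A_E V) {η : ℝ} (hη0 : 0 < η)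
    (hη : η < 1) :
    ∃ D : ℝ, 0 < D ∧ ∀ z : E3, ∃ x ∈ Metric.ball z D,
      ∀ y ∈ Metric.closedBall x (η / (2 * (A 1 + 1))), ‖V y‖ ≤ 1 - η / 2 := by
  obtain ⟨D, hD, hd⟩ := slack_dense hV.continuous hG hη
  have hA1 : 0 ≤ A 1 := le_trans (norm_nonneg _) (hA 1 0)
  refine ⟨D, hD, fun z => ?_⟩
  obtain ⟨x, hx, hVx⟩ := hd z
  refine ⟨x, hx, fun y hy => ?_⟩
  have hlip := norm_sub_le_of_budget hV hA x y
  have hy' : ‖y - x‖ ≤ η / (2 * (A 1 + 1)) := by rwa [Metric.mem_closedBall, dist_eq_norm] at hy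
  have hq : A 1 / (A 1 + 1) ≤ 1 := by rw [div_le_one (by linarith)]; linarith
  have h1 : A 1 * ‖y - x‖ ≤ η / 2 :=
    calc A 1 * ‖y - x‖ ≤ A 1 * (η / (2 * (A 1 + 1))) := mul_le_mul_of_nonneg_left hy' hA1
      _ = (η / 2) * (A 1 / (A 1 + 1)) := by field_simp
      _ ≤ (η / 2) * 1 := mul_le_mul_of_nonneg_left hq (by linarith)
      _ = η / 2 := mul_one _
  calc ‖V y‖ = ‖V x + (V y - V x)‖ := by congr 1; abel
    _ ≤ ‖V x‖ + ‖V y - V x‖ := norm_add_le _ _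
    _ ≤ (1 - η) + η / 2 := add_le_add hVx (hlip.trans h1)
    _ = 1 - η / 2 := by ring

/-- **NEAR-TOP VOLUME IS LINEAR (PROVED; Chebyshev on the energy).**  For continuous `V` with linear energy growth the near-top set
`{‖V‖ > 1 − η}` meets every ball `B(z,R)` in volume `≤ A_E R / (1 − η)²` — the count behind "at most `O(A_E r)` cells" and behind the
flux/isoperimetry argument for `Escape` (a trapped reachable set would have to be volumetrically one-dimensional). -/
theorem volume_nearTop_inter_ball_le {A_E : ℝ} {V : E3 → E3} (hV : Continuous V) (hG : HasLinearGrowth A_E V)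
    {η : ℝ} (hη : η < 1) (z : E3) {R : ℝ} (hR : 0 < R) :
    (volume ({y : E3 | 1 - η < ‖V y‖} ∩ Metric.ball z R)).toReal ≤ A_E * R / (1 - η) ^ 2 := by
  set S : Set E3 := {y : E3 | 1 - η < ‖V y‖} ∩ Metric.ball z R with hS
  have hSo : IsOpen S := (isOpen_lt continuous_const hV.norm).inter Metric.isOpen_ball
  have hSm : MeasurableSet S := hSo.measurableSet
  have hSsub : S ⊆ Metric.ball z R := Set.inter_subset_right
  have hSfin : volume S ≠ ⊤ := ((measure_mono hSsub).trans_lt measure_ball_lt_top).ne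
  have hint : IntegrableOn (fun x => ‖V x‖ ^ 2) (Metric.ball z R) volume :=
    ((hV.norm.pow 2).continuousOn.integrableOn_compact (isCompact_closedBall z R)).mono_set Metric.ball_subset_closedBall
  have hpos : 0 < (1 - η) ^ 2 := pow_pos (by linarith) 2
  have hlow : ∫ x in S, (1 - η) ^ 2 ≤ ∫ x in S, ‖V x‖ ^ 2 := by
    refine setIntegral_mono_on (integrableOn_const hSfin) (hint.mono_set hSsub) hSm fun x hx => ?_
    have h1 : 1 - η < ‖V x‖ := hx.1
    have h0 : 0 ≤ 1 - η := by linarith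
    nlinarith
  have hconst : ∫ x in S, (1 - η) ^ 2 = (volume S).toReal * (1 - η) ^ 2 := by
    rw [setIntegral_const, smul_eq_mul, measureReal_def]
  have hmid : ∫ x in S, ‖V x‖ ^ 2 ≤ ∫ x in Metric.ball z R, ‖V x‖ ^ 2 :=
    setIntegral_mono_set hint (Filter.Eventually.of_forall fun x => sq_nonneg ‖V x‖) hSsub.eventuallyLE
  have hup : ∫ x in Metric.ball z R, ‖V x‖ ^ 2 ≤ A_E * R := hG z R hR
  rw [hconst] at hlow
  rw [le_div_iff₀ hpos]
  linarith

/-- **THE WALL LEMMA (PROVED; pointwise core of the no-trap argument for `Escape`).**  If at a point NO direction of the closed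
`θ`-backward cone `{w | ⟪V, w⟫ ≤ −θ‖w‖}` points strictly to the side of the unit vector `n` (think: `n` = outward normal of a trapped
reachable set), then `V` itself points along `n`: `⟪V, n⟫ ≥ 0` and `⟪V, n⟫² ≥ ‖V‖² − θ²`, i.e. `⟪V, n⟫ ≥ √(‖V‖² − θ²)` — on the near-top
set (`‖V‖ ≥ 1/2`, `θ ≤ 1/4`) an OUTWARD FLUX density `≥ (√3/2)‖V‖`, which the divergence theorem + linear growth + isoperimetry forbid
on a trapped set (docstring of §3f).  Proof: test the cone's boundary ray `−(θ/‖V‖²)… V + √(1 − θ²/‖V‖²)·e` with `e` the unit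
component of `n` orthogonal to `V`, and the ray `−V` for the sign. -/
theorem inner_normal_of_noEscapeDir {V n : E3} {θ : ℝ} (hθ : 0 < θ) (hVθ : θ < ‖V‖) (hn : ‖n‖ = 1)
    (h : ∀ w : E3, ⟪V, w⟫_ℝ ≤ -(θ * ‖w‖) → ⟪w, n⟫_ℝ ≤ 0) :
    0 ≤ ⟪V, n⟫_ℝ ∧ ‖V‖ ^ 2 - θ ^ 2 ≤ ⟪V, n⟫_ℝ ^ 2 := by
  have hV : 0 < ‖V‖ := hθ.trans hVθ
  have hV2 : 0 < ‖V‖ ^ 2 := pow_pos hV 2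
  have ha0 : 0 ≤ ⟪V, n⟫_ℝ := by
    have hw := h (-V) (by
      rw [inner_neg_right, real_inner_self_eq_norm_sq, norm_neg]
      nlinarith)
    rw [inner_neg_left] at hw
    linarith
  refine ⟨ha0, ?_⟩
  set a : ℝ := ⟪V, n⟫_ℝ with ha
  set u : E3 := n - (a / ‖V‖ ^ 2) • V with hu
  have hVu : ⟪V, u⟫_ℝ = 0 := by
    rw [hu, inner_sub_right, real_inner_smul_right, real_inner_self_eq_norm_sq, ← ha, div_mul_cancel₀ a hV2.ne', sub_self]
  have hdecomp : n = u + (a / ‖V‖ ^ 2) • V := by rw [hu]; abel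
  have hnu : ‖u‖ ^ 2 = 1 - a ^ 2 / ‖V‖ ^ 2 := by
    have h1 : ‖n‖ ^ 2 = ‖u‖ ^ 2 + 2 * ⟪u, (a / ‖V‖ ^ 2) • V⟫_ℝ + ‖(a / ‖V‖ ^ 2) • V‖ ^ 2 := by
      conv_lhs => rw [hdecomp]
      exact norm_add_sq_real _ _
    have h2 : ⟪u, (a / ‖V‖ ^ 2) • V⟫_ℝ = 0 := by rw [real_inner_smul_right, real_inner_comm V u, hVu, mul_zero]
    have h3 : ‖(a / ‖V‖ ^ 2) • V‖ ^ 2 = a ^ 2 / ‖V‖ ^ 2 := by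
      rw [norm_smul, mul_pow, Real.norm_eq_abs, sq_abs]
      field_simp
    rw [hn, one_pow, h2, h3] at h1
    linarith
  set c : ℝ := θ / ‖V‖ with hc
  have hc0 : 0 < c := div_pos hθ hV
  have hc1 : c < 1 := (div_lt_one hV).mpr hVθ
  have hcV : c * ‖V‖ = θ := div_mul_cancel₀ θ hV.ne'
  have h1c : 0 < 1 - c ^ 2 := by nlinarith
  set s : ℝ := Real.sqrt (1 - c ^ 2) with hs
  have hs0 : 0 < s := Real.sqrt_pos.mpr h1c
  have hs2 : s ^ 2 = 1 - c ^ 2 := Real.sq_sqrt h1c.le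
  by_cases hu0 : u = 0
  · have h0 : (0 : ℝ) = 1 - a ^ 2 / ‖V‖ ^ 2 := by simpa [hu0] using hnu
    have ha2 : a ^ 2 = ‖V‖ ^ 2 := by
      rw [← div_mul_cancel₀ (a ^ 2) hV2.ne', show a ^ 2 / ‖V‖ ^ 2 = 1 by linarith, one_mul]
    nlinarith [ha2, sq_nonneg θ]
  · have hupos : 0 < ‖u‖ := norm_pos_iff.mpr hu0
    set w : E3 := (-(c / ‖V‖)) • V + (s / ‖u‖) • u with hw
    have hVw : ⟪V, w⟫_ℝ = -θ := by
      rw [hw, inner_add_right, real_inner_smul_right, real_inner_smul_right, real_inner_self_eq_norm_sq, hVu, mul_zero,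
        add_zero, ← hcV]
      field_simp
    have e1 : ⟪(-(c / ‖V‖)) • V, (s / ‖u‖) • u⟫_ℝ = 0 := by
      rw [real_inner_smul_left, real_inner_smul_right, hVu, mul_zero, mul_zero]
    have e2 : ‖(-(c / ‖V‖)) • V‖ ^ 2 = c ^ 2 := by
      rw [norm_smul, norm_neg, Real.norm_eq_abs, abs_of_pos (div_pos hc0 hV), div_mul_cancel₀ c hV.ne']
    have e3 : ‖(s / ‖u‖) • u‖ ^ 2 = s ^ 2 := by
      rw [norm_smul, Real.norm_eq_abs, abs_of_pos (div_pos hs0 hupos), div_mul_cancel₀ s hupos.ne']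
    have hwn2 : ‖w‖ ^ 2 = 1 := by
      rw [hw, norm_add_sq_real, e1, e2, e3, hs2]
      ring
    have hwn : ‖w‖ = 1 := (pow_eq_one_iff_of_nonneg (norm_nonneg w) two_ne_zero).mp hwn2
    have hun : ⟪u, n⟫_ℝ = ‖u‖ ^ 2 := by
      conv_lhs => rw [hdecomp]
      rw [inner_add_right, real_inner_smul_right, real_inner_comm V u, hVu, mul_zero, add_zero, real_inner_self_eq_norm_sq]
    have hwn' : ⟪w, n⟫_ℝ = -(c / ‖V‖) * a + s * ‖u‖ := by
      rw [hw, inner_add_left, real_inner_smul_left, real_inner_smul_left, ← ha, hun, pow_two, ← mul_assoc,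
        div_mul_cancel₀ s hupos.ne']
    have key := h w (by rw [hVw, hwn, mul_one])
    rw [hwn'] at key
    have hsu : s * ‖u‖ ≤ c / ‖V‖ * a := by linarith
    have hsq : (s * ‖u‖) ^ 2 ≤ (c / ‖V‖ * a) ^ 2 := pow_le_pow_left₀ (by positivity) hsu 2
    rw [mul_pow, mul_pow, hs2, hnu] at hsq
    have hT : 1 - c ^ 2 ≤ a ^ 2 / ‖V‖ ^ 2 := by
      have e4 : (c / ‖V‖) ^ 2 * a ^ 2 = c ^ 2 * (a ^ 2 / ‖V‖ ^ 2) := by ring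
      rw [e4] at hsq
      nlinarith [hsq]
    have ht : a ^ 2 / ‖V‖ ^ 2 * ‖V‖ ^ 2 = a ^ 2 := div_mul_cancel₀ _ hV2.ne'
    rw [← hcV]
    calc ‖V‖ ^ 2 - (c * ‖V‖) ^ 2 = (1 - c ^ 2) * ‖V‖ ^ 2 := by ring
      _ ≤ a ^ 2 / ‖V‖ ^ 2 * ‖V‖ ^ 2 := mul_le_mul_of_nonneg_right hT hV2.le
      _ = a ^ 2 := ht

/-- **DOUBLING-REGULAR SCALE (PROVED; pigeonhole).**  If `b K < M^K · b 0` then some step `k < K` has ratio `b (k+1) ≤ M · b k`.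
Used with `b k = bulk(B(y, R₀·4ᵏ))`, `M = 256`: polynomial growth `bulk(B_R) ≤ C(A) R³` against `bulk(B(y,1)) > 0` yields, in every
range of `K ≍ log(C R₀³ / b₀)` consecutive scales, a radius `r` with `bulk(B_{4r}) ≤ 256 · bulk(B_r)` — the two-scale doubling radius of the
error budget. -/
theorem exists_step_ratio_le {b : ℕ → ℝ} {M : ℝ} (hM : 0 ≤ M) {K : ℕ} (hK : b K < M ^ K * b 0) :
    ∃ k < K, b (k + 1) ≤ M * b k := by
  by_contra hcon
  push Not at hcon
  have key : ∀ k ≤ K, M ^ k * b 0 ≤ b k := by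
    intro k hk
    induction k with
    | zero => simp
    | succ k ih =>
      have h1 : M ^ k * b 0 ≤ b k := ih (Nat.le_of_succ_le hk)
      have h2 : M * b k < b (k + 1) := hcon k (Nat.lt_of_succ_le hk)
      calc M ^ (k + 1) * b 0 = M * (M ^ k * b 0) := by ring
        _ ≤ M * b k := mul_le_mul_of_nonneg_left h1 hM
        _ ≤ b (k + 1) := h2.le
  exact absurd hK (not_lt.mpr (key K le_rfl))

/-- **TWO-SCALE DOUBLING RADIUS FROM POLYNOMIAL GROWTH (PROVED; real-variable form).**  If `f(R₀) > 0` and `f(R) ≤ C R³` for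
`R ≥ R₀ > 0` (any `f`, no monotonicity needed) then some `r = R₀·4ᵏ` has `f(4r) ≤ 256·f(r)`.  Instantiate with
`f R = ∫_{B(y,R)}(|curl V|² + |∇curl V|²)`: growth from the derivative budget, `f(1) > 0` from `curl V y ≠ 0`. -/
theorem exists_twoScale_radius {f : ℝ → ℝ} {R₀ C : ℝ} (hR₀ : 0 < R₀) (hpos : 0 < f R₀)
    (hgrowth : ∀ R : ℝ, R₀ ≤ R → f R ≤ C * R ^ 3) : ∃ k : ℕ, f (4 * (R₀ * 4 ^ k)) ≤ 256 * f (R₀ * 4 ^ k) := by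
  obtain ⟨K, hK⟩ := pow_unbounded_of_one_lt (C * R₀ ^ 3 / f R₀) (by norm_num : (1 : ℝ) < 4)
  have hb : f (R₀ * 4 ^ K) < 256 ^ K * f (R₀ * 4 ^ 0) := by
    rw [pow_zero, mul_one]
    have h1 : f (R₀ * 4 ^ K) ≤ C * (R₀ * 4 ^ K) ^ 3 :=
      hgrowth _ (le_mul_of_one_le_right hR₀.le (one_le_pow₀ (by norm_num)))
    have h2 : C * R₀ ^ 3 < 4 ^ K * f R₀ := by
      have := (div_lt_iff₀ hpos).mp hK
      linarith
    have h3 : (256 : ℝ) ^ K = 4 ^ K * (4 ^ K) ^ 3 := by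
      rw [← pow_mul, ← pow_add, show (256 : ℝ) = 4 ^ 4 by norm_num, ← pow_mul]; ring_nf
    have h4 : 0 < ((4 : ℝ) ^ K) ^ 3 := by positivity
    calc f (R₀ * 4 ^ K) ≤ C * (R₀ * 4 ^ K) ^ 3 := h1
      _ = C * R₀ ^ 3 * (4 ^ K) ^ 3 := by ring
      _ < 4 ^ K * f R₀ * (4 ^ K) ^ 3 := mul_lt_mul_of_pos_right h2 h4
      _ = 256 ^ K * f R₀ := by rw [h3]; ring
  obtain ⟨k, -, hk⟩ := exists_step_ratio_le (b := fun k => f (R₀ * 4 ^ k)) (by norm_num : (0 : ℝ) ≤ 256) hb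
  refine ⟨k, ?_⟩
  have : R₀ * 4 ^ (k + 1) = 4 * (R₀ * 4 ^ k) := by ring
  simpa [this] using hk

/-- **CUT-OFFS EXIST (PROVED; Mathlib's `ContDiffBump`).**  The `χ` of `HasAmplitudeTests`: smooth, `= 1` on `B(y,r)`, supported in
`closedBall y (2r)`, values in `[0,1]`, compactly supported.  (Quantitative derivative bounds `‖Dᵏχ‖ ≲ r⁻ᵏ` come from scaling one profile.) -/
theorem exists_cutoff (y : E3) {r : ℝ} (hr : 0 < r) :
    ∃ χ : E3 → ℝ, ContDiff ℝ (⊤ : ℕ∞) χ ∧ HasCompactSupport χ ∧ (∀ x ∈ Metric.ball y r, χ x = 1) ∧ (∀ x, 0 ≤ χ x) ∧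
      (∀ x, χ x ≤ 1) ∧ tsupport χ = Metric.closedBall y (2 * r) := by
  let f : ContDiffBump y := ⟨r, 2 * r, hr, by linarith⟩
  refine ⟨f, f.contDiff, f.hasCompactSupport, fun x hx => f.one_of_mem_closedBall (Metric.ball_subset_closedBall hx),
    fun x => f.nonneg, fun x => f.le_one, f.tsupport_eq⟩

end KinematicBricks

/-! ## §3 The statements of the line (`Sig.*`) and the five REGISTERED-BY-TEXT stubs

(ACL note: this seat may not run `ledger skeleton check` on the crux item; the stubs are registered by the text of this
file and the card.) -/

namespace Sig

/-- L1 · THE LOCAL SLACK INEQUALITY (S/M).  For admissible `v` of height `M`, positive budgets, `(κ⋆−ε)M√Z√W ≤ J(v)`,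
and finitely many admissible local tests with pairwise disjoint supports, the local gains (constants `κ⋆M`, `λ = lam v`)
sum to at most the global defect `εM√Z√W`.  Proof route: joint field `w = v + Σφᵢ` is admissible (disjoint supports);
additivity of the three increments over `i` (germs: off `tsupport φⱼ` the field `φⱼ` vanishes near the point);
`DepletionLadder.sharpDepletion_is_universal` for `w`; `lsi_abstract` with `u=√Z, w=√W, p=√Z(w), q=√W(w)`. -/
abbrev LocalSlack : Prop := Summit.NavierStokesRegularity.NavierStokesRegularity.Theorems.NearExtremalTransiencePerFlow.LocalMaximiser.LocalSlack

/-- L2 · THICK GOOD CENTRE from slack-summability (M).  In the `A`-regular admissible class there is `θ₀(A) > 0` such that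
for every radius `R` and tolerance `η` some `ε₀(A,R,η) > 0` works: if the local gains of every disjoint admissible test
family sum to `≤ εM√Z√W` (the conclusion of L1) with `ε ≤ ε₀`, then some centre `x₀` carries THICK vorticity
`‖curl v x₀‖ ≥ θ₀M/λ` and every admissible test inside `B(x₀, Rλ)` gains at most `ηM³`.  Proof route: 27-colouring of
the `4Rλ`-grid (same-colour balls of radius `Rλ` are disjoint); thin-vorticity inefficiency
`∫_{‖ω‖<θ₀M/λ} ω·Dv ω ≤ θ₀M√Z√W` (uses `‖∇v‖₂ = ‖ω‖₂`) ⇒ thick cubes carry `≥ (κ⋆−ε−θ₀)Z/A₁`; weighted pigeonhole;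
`Z(cube) ≤ 64A₁²M²λR³`. -/
abbrev ThickGoodCentre : Prop := Summit.NavierStokesRegularity.NavierStokesRegularity.Theorems.NearExtremalTransiencePerFlow.LocalMaximiser.ThickGoodCentre

/-- DERIVED (not a stub; PROVED from L1 + L2 as `selection_of`): the thick-good-centre SELECTION with the slack hypothesis
discharged — this is exactly what L3 consumes. -/
abbrev Selection : Prop := Summit.NavierStokesRegularity.NavierStokesRegularity.Theorems.NearExtremalTransiencePerFlow.LocalMaximiser.Selection

/-- L3 · EXTRACTION OF AN ANALYTIC LOCAL MAXIMISER from a violator (M/L; the frame is landed).  Given the thick-good-centre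
selection `Selection` (= L2 with its slack hypothesis discharged by L1; `selection_of`), every violator flow (`IsViolator`: certificate-free Type-I Leray–Hopf flow not extending
past `T` for which the per-flow transience conclusion fails) yields a field in the limit class with non-zero curl.
Proof route: late near-efficient two-sided-locked times (`PerFlow.scaleLock_at_nearEfficient_times`,
`efficientTimesNoDust_holds`), `A`-regularity of the slices (`KNSSBootstrap`), L2 at `(R_n, η_n) → (∞, 0)`; normalise
`x ↦ M⁻¹ v(x₀ + λx)` (height 1, Taylor length 1; `λM/ν ∈ [c₁, c₂]` by the scale lock); Arzelà–Ascoli in `C^k_loc`;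
`IsLocMaxIn` passes to the limit (a robust test of margin `θ` is admissible for every slice within `θ/2` of `V` in `C⁰(tsupport φ)`,
gains are local integrals); linear growth from
`flowFilamentBudget` + scale invariance (`ballEnergy_zoom_le`, `growthTransferFlow`); the limit is a rescaled slice of a
Type-I ancient mild field (`zoomPackageFlow` / `zoomCompactnessKNSS`), hence analytic (`analyticOnNhd_slice`);
`‖curl V 0‖ ≥ θ₀`. -/
abbrev Extraction : Prop := Summit.NavierStokesRegularity.NavierStokesRegularity.Theorems.NearExtremalTransiencePerFlow.LocalMaximiser.Extraction

/-- L5 · NO NEAR-TOP PERCOLATION (M–L; the residual enemy).  In the limit class there is a level `η₀ > 0` such that for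
every `η′ ∈ (0, η₀]` the preconnected subsets of `{‖V‖ > 1 − η′}` are uniformly bounded (levels NEAR THE TOP only — REV 1.1;
far levels such as `{‖V‖ > 0.1}` may well percolate and are never used).  WHY IT MIGHT FAIL: a straight near-top tube (speed
maximal on a cylinder) percolates; the bet is that a tube is not a local maximiser of `F̃` with linear energy growth
(cf. filament_selection's `NoTubeSlice`, here with the extra variational structure). -/
def NoPercolation : Prop :=
  ∀ (A : ℕ → ℝ) (A_E : ℝ) (V : E3 → E3), InLimitClass A A_E V →
    ∃ η₀ : ℝ, 0 < η₀ ∧ ∀ η' : ℝ, 0 < η' → η' ≤ η₀ → ∃ D : ℝ, NearTopBounded V η' D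

/-- L4 · THE HOMOGENEITY CLASH (L; the heart).  A field of the limit class with uniformly bounded near-top components and
no speed plateau has zero curl.  Proof route: (i) two-sided strict tests off the contact set `K = {‖V‖ = 1}` ⇒ the
Euler–Lagrange density of `F̃` (continuous; `KStar.exists_density` pattern) vanishes on the open dense `Kᶜ`, hence
everywhere: `E = ∇q`; (ii) at a doubling-regular radius `r` (exists in every window by `‖DʲV‖ ≤ A_j`) build the
blob-respecting cut-off `χ` (thin shell of width `r^{7/8}`, locally constant on near-top components — possible by the
boundedness hypothesis) and the linear-growth vector potential `ψ` (`|ψ| = O(√A_E log r)`); the lowering test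
`−s(χV + ∇χ × ψ)` is a strict admissible test for `s ∈ (0, η′/2]`; (iii) `E = ∇q` ⇒ first variation `3J_χ − 2K_χ = o`,
`IsLocMax` ⇒ second variation `6J_{χ²} − 2K_{χ²} ≤ o`; `clash_abstract` ⇒ `K_{χ²} ≤ o(K_{χ²})` ⇒ `curl V = 0` near the
centre; analyticity ⇒ everywhere. -/
def HomogeneityClash : Prop :=
  ∀ (A : ℕ → ℝ) (A_E : ℝ) (V : E3 → E3), InLimitClass A A_E V →
    (∃ η₀ : ℝ, 0 < η₀ ∧ ∀ η' : ℝ, 0 < η' → η' ≤ η₀ → ∃ D : ℝ, NearTopBounded V η' D) →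
    interior {x : E3 | ‖V x‖ = 1} = ∅ → ∀ y : E3, curl V y = 0

/-- PARENT NODE of L4/L5 (REV 1.1; not a stub of its own): the LIMIT LIOUVILLE THEOREM «an analytic local maximiser of `F̃` with
linear energy growth and no speed plateau has zero curl».  Registered split: `limitLiouville_of : HomogeneityClash →
NoPercolation → LimitLiouville` (proved).  ALTERNATIVE ROUTE (card §«transverse corrector», no near-top geometry): build the
amplitude test with a divergence corrector `ζ ⊥ V` on the near-top set instead of a blob-respecting `χ`; its own residual
is the polynomial solvability of `div ζ = −V·∇χ`, `ζ·V = 0` on near-top regions of extent `≤ r^{7/16}` (good sub-layer). -/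
def LimitLiouville : Prop :=
  ∀ (A : ℕ → ℝ) (A_E : ℝ) (V : E3 → E3), InLimitClass A A_E V →
    interior {x : E3 | ‖V x‖ = 1} = ∅ → ∀ y : E3, curl V y = 0

end Sig

/-! ## §3a L1 PROVED (REV 1.2): the local slack inequality

Germ-locality of the three densities (each is a function of the 1-jets of `V` and `curl V` at the point), the joint
field `v + Σφᵢ` (admissible by `KStar.admissible_add_smul` applied to the finite sum, height `M` by disjointness of the
supports), universality of `κ⋆` (`DepletionLadder.sharpDepletion_is_universal`) and `lsi_abstract`. -/

section LocalSlackProof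

open Summit.NavierStokesRegularity.NavierStokesRegularity.Theorems.DepletionLadder

theorem curl_congr_of_eventuallyEq {V₁ V₂ : E3 → E3} {x : E3} (h : V₁ =ᶠ[𝓝 x] V₂) :
    curl V₁ x = curl V₂ x := by
  simp only [curl, h.fderiv_eq]

theorem curl_eventuallyEq_of_eventuallyEq {V₁ V₂ : E3 → E3} {x : E3} (h : V₁ =ᶠ[𝓝 x] V₂) :
    curl V₁ =ᶠ[𝓝 x] curl V₂ :=
  h.eventuallyEq_nhds.mono fun _ hy => curl_congr_of_eventuallyEq hy

theorem sd_congr {V₁ V₂ : E3 → E3} {x : E3} (h : V₁ =ᶠ[𝓝 x] V₂) : sd V₁ x = sd V₂ x := by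
  unfold sd; rw [curl_congr_of_eventuallyEq h, h.fderiv_eq]

theorem zd_congr {V₁ V₂ : E3 → E3} {x : E3} (h : V₁ =ᶠ[𝓝 x] V₂) : zd V₁ x = zd V₂ x := by
  unfold zd; rw [curl_congr_of_eventuallyEq h]

theorem wd_congr {V₁ V₂ : E3 → E3} {x : E3} (h : V₁ =ᶠ[𝓝 x] V₂) : wd V₁ x = wd V₂ x := by
  unfold wd; rw [(curl_eventuallyEq_of_eventuallyEq h).fderiv_eq]

theorem divergence_congr_of_eventuallyEq {V₁ V₂ : E3 → E3} {x : E3} (h : V₁ =ᶠ[𝓝 x] V₂) :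
    VectorCalculus.divergence V₁ x = VectorCalculus.divergence V₂ x := by
  simp only [VectorCalculus.divergence, h.fderiv_eq]

/-- The gain integrand of `locGain`. -/
def gi (κ μ : ℝ) (V φ : E3 → E3) (x : E3) : ℝ :=
  (sd (V + φ) x - sd V x) - (κ / 2) * (μ⁻¹ * (zd (V + φ) x - zd V x) + μ * (wd (V + φ) x - wd V x))

theorem locGain_eq (κ μ : ℝ) (V φ : E3 → E3) : locGain κ μ V φ = ∫ x, gi κ μ V φ x := rfl

theorem gi_congr {κ μ : ℝ} {V φ₁ φ₂ : E3 → E3} {x : E3} (h : (V + φ₁) =ᶠ[𝓝 x] (V + φ₂)) :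
    gi κ μ V φ₁ x = gi κ μ V φ₂ x := by
  unfold gi; rw [sd_congr h, zd_congr h, wd_congr h]

theorem add_eventuallyEq_of_notMem {V φ : E3 → E3} {x : E3} (hx : x ∉ tsupport φ) : (V + φ) =ᶠ[𝓝 x] V :=
  (notMem_tsupport_iff_eventuallyEq.1 hx).mono fun y hy => by
    simp only [Pi.add_apply, hy, Pi.zero_apply, add_zero]

theorem gi_eq_zero_of_notMem {κ μ : ℝ} {V φ : E3 → E3} {x : E3} (hx : x ∉ tsupport φ) : gi κ μ V φ x = 0 := by
  have h : (V + φ) =ᶠ[𝓝 x] (V + 0) := by rw [add_zero]; exact add_eventuallyEq_of_notMem hx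
  rw [gi_congr h]; simp [gi]

theorem continuous_sd {V : E3 → E3} (hV : ContDiff ℝ (⊤ : ℕ∞) V) : Continuous (sd V) := by
  have cω : Continuous (curl V) := continuous_curl (hV.of_le (by norm_cast))
  unfold sd
  exact cω.inner ((hV.continuous_fderiv (by simp)).clm_apply cω)

theorem continuous_zd {V : E3 → E3} (hV : ContDiff ℝ (⊤ : ℕ∞) V) : Continuous (zd V) := by
  have cω : Continuous (curl V) := continuous_curl (hV.of_le (by norm_cast))
  unfold zd
  exact (cω.norm).pow 2

theorem continuous_wd {V : E3 → E3} (hV : ContDiff ℝ (⊤ : ℕ∞) V) : Continuous (wd V) := by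
  have hω1 : ContDiff ℝ 1 (curl V) := contDiff_curl (n := 1) (hV.of_le (by norm_cast))
  unfold wd
  exact continuous_frobeniusNormSq_fderiv hω1 one_ne_zero

theorem continuous_gi {κ μ : ℝ} {V φ : E3 → E3} (hV : ContDiff ℝ (⊤ : ℕ∞) V) (hφ : ContDiff ℝ (⊤ : ℕ∞) φ) :
    Continuous (gi κ μ V φ) := by
  have hVφ : ContDiff ℝ (⊤ : ℕ∞) (V + φ) := hV.add hφ
  unfold gi
  exact ((continuous_sd hVφ).sub (continuous_sd hV)).sub
    (continuous_const.mul ((continuous_const.mul ((continuous_zd hVφ).sub (continuous_zd hV))).add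
      (continuous_const.mul ((continuous_wd hVφ).sub (continuous_wd hV)))))

theorem integrable_gi {κ μ : ℝ} {V φ : E3 → E3} (hV : ContDiff ℝ (⊤ : ℕ∞) V) (hφ : ContDiff ℝ (⊤ : ℕ∞) φ)
    (hφc : HasCompactSupport φ) : Integrable (gi κ μ V φ) :=
  (continuous_gi hV hφ).integrable_of_hasCompactSupport
    (HasCompactSupport.intro hφc fun _ hx => gi_eq_zero_of_notMem hx)

/-- **L1 proved.** -/
theorem localSlack_holds : Sig.LocalSlack := by
  intro v M B ε k φ hadm hZ hW hext hφ hdisj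
  obtain ⟨hv, hdiv, hvM, hvB, h0, h1, h2⟩ := hadm
  -- disjointness bookkeeping
  have notMem : ∀ {x : E3} {i j : Fin k}, x ∈ tsupport (φ i) → j ≠ i → x ∉ tsupport (φ j) :=
    fun {x i j} hxi hji => Set.disjoint_left.1 (hdisj i j (Ne.symm hji)) hxi
  -- the joint perturbation
  set Φ : E3 → E3 := fun y => ∑ i, φ i y with hΦdef
  have hΦs : ContDiff ℝ (⊤ : ℕ∞) Φ := ContDiff.sum fun i _ => (hφ i).1
  have hsub : tsupport Φ ⊆ ⋃ i, tsupport (φ i) := by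
    refine closure_minimal (fun y hy => ?_) (isClosed_iUnion_of_finite fun i => isClosed_tsupport _)
    by_contra hcon
    simp only [Set.mem_iUnion, not_exists] at hcon
    exact hy (Finset.sum_eq_zero fun i _ => image_eq_zero_of_notMem_tsupport (hcon i))
  have hΦc : HasCompactSupport Φ :=
    (isCompact_iUnion fun i => (hφ i).2.1).of_isClosed_subset (isClosed_tsupport _) hsub
  -- germs of `Φ`: near a point of `tsupport (φ i)` it is `φ i`, elsewhere it is `0`
  have germB : ∀ {x : E3} {i : Fin k}, x ∈ tsupport (φ i) → Φ =ᶠ[𝓝 x] φ i := by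
    intro x i hxi
    have hall : ∀ᶠ y in 𝓝 x, ∀ j ∈ (Finset.univ.erase i), φ j y = 0 :=
      (Filter.eventually_all_finset _).2 fun j hj =>
        (notMem_tsupport_iff_eventuallyEq.1 (notMem hxi (Finset.ne_of_mem_erase hj))).mono fun y hy => hy
    refine hall.mono fun y hy => ?_
    show ∑ j, φ j y = φ i y
    rw [← Finset.add_sum_erase _ _ (Finset.mem_univ i), Finset.sum_eq_zero hy, add_zero]
  have germA : ∀ {x : E3}, (∀ i, x ∉ tsupport (φ i)) → Φ =ᶠ[𝓝 x] 0 := by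
    intro x hx
    refine notMem_tsupport_iff_eventuallyEq.1 fun hxΦ => ?_
    obtain ⟨i, hi⟩ := Set.mem_iUnion.1 (hsub hxΦ)
    exact hx i hi
  have valB : ∀ {x : E3} {i : Fin k}, x ∈ tsupport (φ i) → Φ x = φ i x := fun hxi => (germB hxi).self_of_nhds
  have valA : ∀ {x : E3}, (∀ i, x ∉ tsupport (φ i)) → Φ x = 0 := fun hx => (germA hx).self_of_nhds
  have hΦdiv : VectorCalculus.IsDivFree Φ := by
    intro x
    by_cases hB : ∃ i, x ∈ tsupport (φ i)
    · obtain ⟨i, hxi⟩ := hB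
      rw [divergence_congr_of_eventuallyEq (germB hxi)]; exact (hφ i).2.2.1 x
    · push Not at hB
      rw [divergence_congr_of_eventuallyEq (germA hB)]
      simp [VectorCalculus.divergence]
  -- the joint field is admissible of height `M`
  have hWeq : (fun y => v y + (1 : ℝ) • Φ y) = v + Φ := by funext y; simp
  have hadmW := KStar.admissible_add_smul hv hdiv hvB h0 h1 h2 hΦs hΦc hΦdiv (1 : ℝ)
  rw [hWeq] at hadmW
  obtain ⟨hWs, hWdiv, ⟨B', hB'⟩, hW0, hW1, hW2⟩ := hadmW
  have hWM : ∀ x, ‖(v + Φ) x‖ ≤ M := by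
    intro x
    by_cases hB : ∃ i, x ∈ tsupport (φ i)
    · obtain ⟨i, hxi⟩ := hB
      rw [Pi.add_apply, valB hxi]; exact (hφ i).2.2.2 x hxi
    · push Not at hB
      rw [Pi.add_apply, valA hB, add_zero]; exact hvM x
  have huniv := sharpDepletion_is_universal (v + Φ) M B' hWs hWdiv hWM hB' hW0 hW1 hW2
  have hJ' : Jst (v + Φ) ≤ kStar * M * Real.sqrt (Zen (v + Φ)) * Real.sqrt (Wpa (v + Φ)) :=
    le_trans (le_abs_self _) huniv
  -- additivity of the gains over the disjoint family
  have hpt : ∀ x, gi (kStar * M) (lam v) v Φ x = ∑ i, gi (kStar * M) (lam v) v (φ i) x := by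
    intro x
    by_cases hB : ∃ i, x ∈ tsupport (φ i)
    · obtain ⟨i, hxi⟩ := hB
      have hg : (v + Φ) =ᶠ[𝓝 x] (v + φ i) :=
        (germB hxi).mono fun y hy => by simp only [Pi.add_apply, hy]
      rw [gi_congr hg, Finset.sum_eq_single i (fun j _ hji => gi_eq_zero_of_notMem (notMem hxi hji))
        (fun h => (h (Finset.mem_univ i)).elim)]
    · push Not at hB
      have hxΦ : x ∉ tsupport Φ := fun h => by
        obtain ⟨i, hi⟩ := Set.mem_iUnion.1 (hsub h); exact hB i hi
      rw [gi_eq_zero_of_notMem hxΦ, Finset.sum_eq_zero fun i _ => gi_eq_zero_of_notMem (hB i)]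
  have hsum1 : ∑ i, locGain (kStar * M) (lam v) v (φ i) = ∫ x, gi (kStar * M) (lam v) v Φ x := by
    simp_rw [locGain_eq, hpt]
    exact (integral_finsetSum _ fun i _ => integrable_gi hv (hφ i).1 (hφ i).2.1).symm
  -- splitting the joint gain into the six budgets
  have isd : Integrable (sd v) := by unfold sd; exact KStar.integrable_stretching hv hvB h1
  have isd' : Integrable (sd (v + Φ)) := by unfold sd; exact KStar.integrable_stretching hWs hB' hW1
  have izd : Integrable (zd v) := by
    unfold zd; exact (integrable_norm_curl_sq (hv.of_le (by norm_cast)) h1).1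
  have izd' : Integrable (zd (v + Φ)) := by
    unfold zd; exact (integrable_norm_curl_sq (hWs.of_le (by norm_cast)) hW1).1
  have iwd : Integrable (wd v) := by
    unfold wd; exact (integrable_frobeniusNormSq_fderiv_curl (hv.of_le (by norm_cast)) h2).1
  have iwd' : Integrable (wd (v + Φ)) := by
    unfold wd; exact (integrable_frobeniusNormSq_fderiv_curl (hWs.of_le (by norm_cast)) hW2).1
  have hsplit : ∫ x, gi (kStar * M) (lam v) v Φ x =
      (Jst (v + Φ) - Jst v) - (kStar * M) / 2 * ((lam v)⁻¹ * (Zen (v + Φ) - Zen v) + lam v * (Wpa (v + Φ) - Wpa v)) := by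
    have iA : Integrable (fun x => sd (v + Φ) x - sd v x) := isd'.sub isd
    have iE : Integrable (fun x => (lam v)⁻¹ * (zd (v + Φ) x - zd v x)) := (izd'.sub izd).const_mul _
    have iH : Integrable (fun x => lam v * (wd (v + Φ) x - wd v x)) := (iwd'.sub iwd).const_mul _
    have iEH : Integrable (fun x => (lam v)⁻¹ * (zd (v + Φ) x - zd v x) + lam v * (wd (v + Φ) x - wd v x)) := iE.add iH
    have iC : Integrable (fun x => (kStar * M) / 2 *
        ((lam v)⁻¹ * (zd (v + Φ) x - zd v x) + lam v * (wd (v + Φ) x - wd v x))) := iEH.const_mul _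
    have e0 : (∫ x, gi (kStar * M) (lam v) v Φ x) = ∫ x, ((sd (v + Φ) x - sd v x) - (kStar * M) / 2 *
        ((lam v)⁻¹ * (zd (v + Φ) x - zd v x) + lam v * (wd (v + Φ) x - wd v x))) := rfl
    rw [e0, integral_sub iA iC, integral_sub isd' isd, integral_const_mul, integral_add iE iH, integral_const_mul,
      integral_const_mul, integral_sub izd' izd, integral_sub iwd' iwd]
    rfl
  -- the abstract tangent-plane inequality
  have hM0 : 0 ≤ M := (norm_nonneg _).trans (hvM 0)
  have hκM : 0 ≤ kStar * M := mul_nonneg kStar_pos.le hM0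
  have hZ'0 : 0 ≤ Zen (v + Φ) := integral_nonneg fun x => sq_nonneg _
  have hW'0 : 0 ≤ Wpa (v + Φ) := integral_nonneg fun x => frobeniusNormSq_nonneg _
  have hu : 0 < Real.sqrt (Zen v) := Real.sqrt_pos.2 hZ
  have hw : 0 < Real.sqrt (Wpa v) := Real.sqrt_pos.2 hW
  have key := lsi_abstract (J := Jst v) (J' := Jst (v + Φ)) (κ := kStar) (M := M) (ε := ε) hu hw
    (Real.sqrt_nonneg (Zen (v + Φ))) (Real.sqrt_nonneg (Wpa (v + Φ))) hκM hJ' hext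
  rw [Real.sq_sqrt hZ'0, Real.sq_sqrt hZ.le, Real.sq_sqrt hW'0, Real.sq_sqrt hW.le] at key
  have hlam : lam v = Real.sqrt (Zen v) / Real.sqrt (Wpa v) := by
    unfold lam; exact Real.sqrt_div' (Zen v) hW.le
  rw [hsum1, hsplit, hlam, inv_div]
  linarith [key]

end LocalSlackProof

/-! ### §2b (continued) — convergence of local gains by dominated convergence (PROVED)

Supplies the hypothesis `hgain` of `isLocMaxIn_of_limit` from pointwise convergence of the gain integrands on
`tsupport φ` with a uniform bound (what `C²_loc`-convergence of the zoom sequence gives). -/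

section GainLimit

/-- Local gains converge under dominated pointwise convergence of the integrands on `tsupport φ`. [folklore] -/
theorem tendsto_locGain_of_dominated {κ μ : ℝ} {V φ : E3 → E3} {v : ℕ → E3 → E3}
    (hv : ∀ n, ContDiff ℝ (⊤ : ℕ∞) (v n)) (hφ : ContDiff ℝ (⊤ : ℕ∞) φ) (hφc : HasCompactSupport φ)
    (hpt : ∀ x ∈ tsupport φ, Tendsto (fun n => gi κ μ (v n) φ x) atTop (𝓝 (gi κ μ V φ x)))
    (hbd : ∃ C : ℝ, ∀ n, ∀ x ∈ tsupport φ, |gi κ μ (v n) φ x| ≤ C) :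
    Tendsto (fun n => locGain κ μ (v n) φ) atTop (𝓝 (locGain κ μ V φ)) := by
  obtain ⟨C, hC⟩ := hbd
  simp only [locGain_eq]
  refine tendsto_integral_of_dominated_convergence ((tsupport φ).indicator fun _ => C)
    (fun n => (continuous_gi (hv n) hφ).aestronglyMeasurable) ?_ (fun n => Eventually.of_forall fun x => ?_)
    (Eventually.of_forall fun x => ?_)
  · rw [integrable_indicator_iff hφc.measurableSet]
    exact integrableOn_const (hφc.measure_lt_top.ne)
  · by_cases hx : x ∈ tsupport φ
    · rw [indicator_of_mem hx, Real.norm_eq_abs]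
      exact hC n x hx
    · rw [indicator_of_notMem hx, gi_eq_zero_of_notMem hx, norm_zero]
  · by_cases hx : x ∈ tsupport φ
    · exact hpt x hx
    · simp only [gi_eq_zero_of_notMem hx]
      exact tendsto_const_nhds

end GainLimit

/-! ## §3b The heart decomposed (REV 2.0): Taylor coefficients of the local gain · Euler–Lagrange · amplitude tests · clash

`s ↦ locGain κ μ V (s•φ)` is an exact cubic `s·a₁ + s²·a₂ + s³·a₃` (pointwise polynomial expansions of the three densities,
all coefficients supported in `tsupport φ`, so no budget finiteness of `V` is needed).  The heart L4 then splits into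
 * L4e `EulerLagrange` — `a₁ ≡ 0` on all compactly supported divergence-free directions when the contact set is thin;
 * L4t `AmplitudeTests` — at a field with `curl V y ≠ 0`, for every `δ > 0`, a one-sided admissible lowering direction `φ`
   (think `−(χV + ζ)`) and a first-order companion `φ'` (think `−(χ²V + ζ')`) whose Taylor coefficients are the weighted
   bulk terms `3J_{χ²} − K_{χ²}` resp. `−(3J_{χ²} − 2K_{χ²})` up to an error `δ·K_{χ²}`;
 * the CLASH `homogeneityClash_of : EulerLagrange → AmplitudeTests → HomogeneityClash`, PROVED below
   (`coeff2_nonpos`, `Kg_pos`, `clash` by `linarith`). -/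

section Heart

open Summit.NavierStokesRegularity.NavierStokesRegularity.Theorems.DepletionLadder

variable {κ μ : ℝ} {V φ : E3 → E3}

/-- first-order stretching coefficient density. -/
def c1 (V φ : E3 → E3) (x : E3) : ℝ :=
  ⟪curl φ x, fderiv ℝ V x (curl V x)⟫_ℝ + ⟪curl V x, fderiv ℝ φ x (curl V x)⟫_ℝ + ⟪curl V x, fderiv ℝ V x (curl φ x)⟫_ℝ
/-- second-order stretching coefficient density. -/
def c2 (V φ : E3 → E3) (x : E3) : ℝ :=
  ⟪curl φ x, fderiv ℝ φ x (curl V x)⟫_ℝ + ⟪curl φ x, fderiv ℝ V x (curl φ x)⟫_ℝ + ⟪curl V x, fderiv ℝ φ x (curl φ x)⟫_ℝ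
/-- third-order stretching coefficient density (the stretching density of `φ` itself). -/
def c3 (φ : E3 → E3) (x : E3) : ℝ := ⟪curl φ x, fderiv ℝ φ x (curl φ x)⟫_ℝ
/-- first-order enstrophy coefficient density `⟪ω, curl φ⟫`. -/
def z1 (V φ : E3 → E3) (x : E3) : ℝ := ⟪curl V x, curl φ x⟫_ℝ
/-- first-order palinstrophy coefficient density `Σᵢ ⟪∂ᵢω, ∂ᵢ curl φ⟫`. -/
def w1 (V φ : E3 → E3) (x : E3) : ℝ :=
  ∑ i, ⟪fderiv ℝ (curl V) x (EuclideanSpace.basisFun (Fin 3) ℝ i), fderiv ℝ (curl φ) x (EuclideanSpace.basisFun (Fin 3) ℝ i)⟫_ℝ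

/-- FIRST TAYLOR COEFFICIENT (first variation) of `s ↦ locGain κ μ V (s•φ)`. -/
def a1 (κ μ : ℝ) (V φ : E3 → E3) : ℝ :=
  ∫ x, (c1 V φ x - (κ / 2) * (μ⁻¹ * (2 * z1 V φ x) + μ * (2 * w1 V φ x)))
/-- SECOND TAYLOR COEFFICIENT (half the second variation) of `s ↦ locGain κ μ V (s•φ)`. -/
def a2 (κ μ : ℝ) (V φ : E3 → E3) : ℝ :=
  ∫ x, (c2 V φ x - (κ / 2) * (μ⁻¹ * zd φ x + μ * wd φ x))
/-- THIRD TAYLOR COEFFICIENT of `s ↦ locGain κ μ V (s•φ)` (independent of `κ, μ, V` except through nothing: it is `J(φ)`-like). -/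
def a3 (φ : E3 → E3) : ℝ := ∫ x, c3 φ x

/-- Pointwise cubic expansion of the gain integrand along `s ↦ V + s•φ`. [folklore] -/
theorem gi_smul (hV : ContDiff ℝ (⊤ : ℕ∞) V) (hφ : ContDiff ℝ (⊤ : ℕ∞) φ) (s : ℝ) (x : E3) :
    gi κ μ V (s • φ) x =
      s * (c1 V φ x - (κ / 2) * (μ⁻¹ * (2 * z1 V φ x) + μ * (2 * w1 V φ x))) +
        s ^ 2 * (c2 V φ x - (κ / 2) * (μ⁻¹ * zd φ x + μ * wd φ x)) + s ^ 3 * c3 φ x := by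
  have hW : V + s • φ = fun y => V y + s • φ y := rfl
  have hVd : Differentiable ℝ V := hV.differentiable (by simp)
  have hφd : Differentiable ℝ φ := hφ.differentiable (by simp)
  have e1 : curl (V + s • φ) x = curl V x + s • curl φ x := by
    rw [hW, KStar.curl_add_smul hVd hφd]
  have e2 : fderiv ℝ (V + s • φ) x = fderiv ℝ V x + s • fderiv ℝ φ x := by
    rw [hW]; exact KStar.fderiv_add_smul hVd hφd s x
  have e3 : fderiv ℝ (curl (V + s • φ)) x = fderiv ℝ (curl V) x + s • fderiv ℝ (curl φ) x := by
    rw [hW]; exact KStar.fderiv_curl_add_smul hV hφ s x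
  simp only [gi, sd, zd, wd, e1, e2, e3, KStar.inner_apply_add_smul_expand, KStar.norm_add_smul_sq_expand,
    KStar.frobeniusNormSq_add_smul_expand, c1, c2, c3, z1, w1]
  ring

/-- **CUBIC STRUCTURE.** `locGain κ μ V (s•φ) = s·a₁ + s²·a₂ + s³·a₃` for smooth `V` and smooth compactly supported `φ`
(no integrability of `V`'s budgets needed: every coefficient is supported in `tsupport φ`). [folklore] -/
theorem locGain_smul (hV : ContDiff ℝ (⊤ : ℕ∞) V) (hφ : ContDiff ℝ (⊤ : ℕ∞) φ) (hφc : HasCompactSupport φ) (s : ℝ) :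
    locGain κ μ V (s • φ) = s * a1 κ μ V φ + s ^ 2 * a2 κ μ V φ + s ^ 3 * a3 φ := by
  have ic1 : Integrable (c1 V φ) := (KStar.integrable_stretching_coeffs hV hφ hφc).1
  have ic2 : Integrable (c2 V φ) := (KStar.integrable_stretching_coeffs hV hφ hφc).2.1
  have ic3 : Integrable (c3 φ) := (KStar.integrable_stretching_coeffs hV hφ hφc).2.2
  have iz1 : Integrable (z1 V φ) := (KStar.integrable_enstrophy_coeffs hV hφ hφc).1
  have izd : Integrable (zd φ) := (KStar.integrable_enstrophy_coeffs hV hφ hφc).2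
  have iw1 : Integrable (w1 V φ) := (KStar.integrable_palinstrophy_coeffs hV hφ hφc).1
  have iwd : Integrable (wd φ) := (KStar.integrable_palinstrophy_coeffs hV hφ hφc).2
  have i1 : Integrable (fun x => c1 V φ x - (κ / 2) * (μ⁻¹ * (2 * z1 V φ x) + μ * (2 * w1 V φ x))) :=
    ic1.sub ((((iz1.const_mul 2).const_mul μ⁻¹).add ((iw1.const_mul 2).const_mul μ)).const_mul (κ / 2))
  have i2 : Integrable (fun x => c2 V φ x - (κ / 2) * (μ⁻¹ * zd φ x + μ * wd φ x)) :=
    ic2.sub (((izd.const_mul μ⁻¹).add (iwd.const_mul μ)).const_mul (κ / 2))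
  have i1s : Integrable (fun x => s * (c1 V φ x - (κ / 2) * (μ⁻¹ * (2 * z1 V φ x) + μ * (2 * w1 V φ x)))) :=
    i1.const_mul s
  have i2s : Integrable (fun x => s ^ 2 * (c2 V φ x - (κ / 2) * (μ⁻¹ * zd φ x + μ * wd φ x))) := i2.const_mul _
  have i3s : Integrable (fun x => s ^ 3 * c3 φ x) := ic3.const_mul _
  have i12 : Integrable (fun x => s * (c1 V φ x - (κ / 2) * (μ⁻¹ * (2 * z1 V φ x) + μ * (2 * w1 V φ x))) +
      s ^ 2 * (c2 V φ x - (κ / 2) * (μ⁻¹ * zd φ x + μ * wd φ x))) := i1s.add i2s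
  have e0 : locGain κ μ V (s • φ) = ∫ x, (s * (c1 V φ x - (κ / 2) * (μ⁻¹ * (2 * z1 V φ x) + μ * (2 * w1 V φ x))) +
      s ^ 2 * (c2 V φ x - (κ / 2) * (μ⁻¹ * zd φ x + μ * wd φ x)) + s ^ 3 * c3 φ x) := by
    rw [locGain_eq]; exact integral_congr_ae (Eventually.of_forall (gi_smul hV hφ s))
  rw [e0, integral_add i12 i3s, integral_add i1s i2s, integral_const_mul, integral_const_mul, integral_const_mul]
  rfl

/-- If `s²·a₂ + s³·a₃ ≤ 0` for all `s ∈ (0,1]` then `a₂ ≤ 0`. [folklore] -/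
theorem coeff2_nonpos {p q s₀ : ℝ} (hs₀ : 0 < s₀) (h : ∀ s : ℝ, 0 < s → s ≤ s₀ → s ^ 2 * p + s ^ 3 * q ≤ 0) :
    p ≤ 0 := by
  by_contra hp
  push Not at hp
  set s : ℝ := min s₀ (p / (2 * (|q| + 1))) with hs
  have hq1 : 0 < |q| + 1 := by positivity
  have hs0 : 0 < s := lt_min hs₀ (div_pos hp (by positivity))
  have hs1 : s ≤ s₀ := min_le_left _ _
  have hs2 : s ≤ p / (2 * (|q| + 1)) := min_le_right _ _
  have h3 : -(s * |q|) ≤ s * q := by nlinarith [neg_abs_le q, hs0.le]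
  have h4 : s * |q| ≤ p / 2 := by
    have hfrac : |q| / (|q| + 1) ≤ 1 := by rw [div_le_one hq1]; linarith
    calc s * |q| ≤ p / (2 * (|q| + 1)) * |q| := by gcongr
      _ = (p / 2) * (|q| / (|q| + 1)) := by field_simp
      _ ≤ (p / 2) * 1 := by gcongr
      _ = p / 2 := mul_one _
  have h5 : 0 < p + s * q := by linarith
  have h6 : 0 < s ^ 2 * p + s ^ 3 * q := by
    have := mul_pos (pow_pos hs0 2) h5
    nlinarith [this]
  linarith [h s hs0 hs1]

/-- weighted stretching bulk `J_{χ²} = ∫ χ²·ξ`. -/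
def Jg (χ : E3 → ℝ) (V : E3 → E3) : ℝ := ∫ x, χ x ^ 2 * sd V x
/-- weighted quadratic bulk `K_{χ²} = (κ⋆/2)∫ χ²(|ω|² + |∇ω|²)`. -/
def Kg (χ : E3 → ℝ) (V : E3 → E3) : ℝ := kStar / 2 * ∫ x, χ x ^ 2 * (zd V x + wd V x)

/-- The weighted quadratic bulk is strictly positive as soon as the weight is `1` on a ball around a point of non-zero
vorticity. [folklore] -/
theorem Kg_pos {V : E3 → E3} {χ : E3 → ℝ} {y : E3} {r : ℝ} (hV : ContDiff ℝ (⊤ : ℕ∞) V) (hχ : Continuous χ)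
    (hχc : HasCompactSupport χ) (hr : 0 < r) (h1 : ∀ x ∈ Metric.ball y r, χ x = 1) (hy : curl V y ≠ 0) :
    0 < Kg χ V := by
  unfold Kg
  refine mul_pos (by have := kStar_pos; positivity) ?_
  set f : E3 → ℝ := fun x => χ x ^ 2 * (zd V x + wd V x) with hf
  have hnn : 0 ≤ f := fun x => by
    have h1' : 0 ≤ zd V x := by unfold zd; positivity
    have h2' : 0 ≤ wd V x := frobeniusNormSq_nonneg _
    show 0 ≤ χ x ^ 2 * (zd V x + wd V x)
    positivity
  have hcont : Continuous f := (hχ.pow 2).mul ((continuous_zd hV).add (continuous_wd hV))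
  have hsupp : HasCompactSupport f := by
    refine HasCompactSupport.intro hχc fun x hx => ?_
    show χ x ^ 2 * (zd V x + wd V x) = 0
    simp [image_eq_zero_of_notMem_tsupport hx]
  have hint : Integrable f := hcont.integrable_of_hasCompactSupport hsupp
  rw [integral_pos_iff_support_of_nonneg hnn hint]
  -- a small ball around `y` lies in the support
  have hcurl : Continuous (curl V) := continuous_curl (hV.of_le (by norm_cast))
  have hev : ∀ᶠ x in 𝓝 y, curl V x ≠ 0 := hcurl.continuousAt.eventually_ne hy
  obtain ⟨ρ, hρ, hρball⟩ := Metric.eventually_nhds_iff.1 hev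
  have hsub : Metric.ball y (min ρ r) ⊆ Function.support f := by
    intro x hx
    have hxρ : dist x y < ρ := lt_of_lt_of_le (Metric.mem_ball.1 hx) (min_le_left _ _)
    have hxr : x ∈ Metric.ball y r := Metric.mem_ball.2 (lt_of_lt_of_le (Metric.mem_ball.1 hx) (min_le_right _ _))
    have hne : curl V x ≠ 0 := hρball hxρ
    have hzd : 0 < zd V x := by unfold zd; positivity
    have hwd : 0 ≤ wd V x := frobeniusNormSq_nonneg _
    rw [Function.mem_support]
    show χ x ^ 2 * (zd V x + wd V x) ≠ 0
    rw [h1 x hxr]; positivity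
  exact lt_of_lt_of_le (Metric.measure_ball_pos volume y (lt_min hρ hr)) (measure_mono hsub)

/-- AMPLITUDE TESTS at a centre `y` (the interface between the geometric construction L4t and the clash): for every
`δ > 0` a radius `r > 0`, a margin `θ > 0`, an amplitude range `s₀ > 0` (REV 3.1), a continuous compactly supported weight `χ`
equal to `1` on `B(y,r)`, a ONE-SIDED ADMISSIBLE direction given as the CURL OF A COMPACTLY SUPPORTED POTENTIAL `η` (`s•curl η` is
a ROBUST test of margin `θ` for all `s ∈ (0,s₀]` — small amplitudes suffice for the clash, and they let the divergence corrector be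
LARGE inside slack regions; think `η = −χψ` with `curl ψ = V` near the ball, so `curl η = −(χV + ∇χ×ψ)`: inward near the top,
slack elsewhere; potentials, not fields, so that Euler–Lagrange is needed only on curls — no `H²_c(ℝ³) = 0`) whose
second Taylor coefficient is `3J_{χ²} − K_{χ²}` up to `δ·K_{χ²}`, and a compactly supported divergence-free companion `φ'`
(think `−(χ²V + ζ')`, admissibility NOT required) whose first Taylor coefficient is `−(3J_{χ²} − 2K_{χ²})` up to `δ·K_{χ²}`. -/
def HasAmplitudeTests (V : E3 → E3) (y : E3) : Prop :=
  ∀ δ : ℝ, 0 < δ → ∃ (r θ s₀ : ℝ) (χ : E3 → ℝ) (η η' : E3 → E3),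
    0 < r ∧ 0 < θ ∧ 0 < s₀ ∧ Continuous χ ∧ HasCompactSupport χ ∧ (∀ x ∈ Metric.ball y r, χ x = 1) ∧
    ContDiff ℝ (⊤ : ℕ∞) η ∧ HasCompactSupport η ∧ (∀ s : ℝ, 0 < s → s ≤ s₀ → IsTestIn V θ (s • curl η)) ∧
    ContDiff ℝ (⊤ : ℕ∞) η' ∧ HasCompactSupport η' ∧
    |a1 kStar 1 V (curl η') + (3 * Jg χ V - 2 * Kg χ V)| ≤ δ * Kg χ V ∧
    |a2 kStar 1 V (curl η) - (3 * Jg χ V - Kg χ V)| ≤ δ * Kg χ V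

/-- `curl η` is smooth for smooth `η`. [folklore] -/
theorem contDiff_curl_top {η : E3 → E3} (h : ContDiff ℝ (⊤ : ℕ∞) η) : ContDiff ℝ (⊤ : ℕ∞) (curl η) :=
  contDiff_curl (n := ⊤) (by simpa using h)

/-- `curl η` is divergence free for smooth `η`. [folklore] -/
theorem isDivFree_curl {η : E3 → E3} (h : ContDiff ℝ (⊤ : ℕ∞) η) : VectorCalculus.IsDivFree (curl η) :=
  fun x => divergence_curl_eq_zero_holds η (h.of_le (by norm_cast)) x

/-- **CLASH CORE (PROVED).**  Smooth `V`, `IsLocMaxIn κ⋆ 1 V`, Euler–Lagrange on all curls of smooth compactly supported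
potentials, and `HasAmplitudeTests V y` ⇒ `curl V y = 0`: with `δ = 1/4`, `a₁(curl η') = 0` gives `3J_{χ²} ≥ (2 − δ)K_{χ²}`;
`a₁(curl η) = 0` and robust maximality along `s•curl η`, `s ∈ (0,s₀]`, give `s²a₂ + s³a₃ ≤ 0`, so `a₂ ≤ 0` (`coeff2_nonpos`), i.e.
`3J_{χ²} ≤ (1 + δ)K_{χ²}`; hence `K_{χ²} ≤ 0`, contradicting `Kg_pos`. -/
theorem clash_core {V : E3 → E3} {y : E3} (hVs : ContDiff ℝ (⊤ : ℕ∞) V) (hmax : IsLocMaxIn kStar 1 V)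
    (hEL : ∀ η : E3 → E3, ContDiff ℝ (⊤ : ℕ∞) η → HasCompactSupport η → a1 kStar 1 V (curl η) = 0)
    (hT : HasAmplitudeTests V y) : curl V y = 0 := by
  by_contra hy
  obtain ⟨r, θ, s₀, χ, η, η', hr, hθ, hs₀, hχ, hχc, hχ1, hηs, hηc, hadm, hη's, hη'c, hb1, hb2⟩ := hT (1 / 4) (by norm_num)
  have hφs : ContDiff ℝ (⊤ : ℕ∞) (curl η) := contDiff_curl_top hηs
  have hφc : HasCompactSupport (curl η) := hasCompactSupport_curl hηc
  have hE1 : a1 kStar 1 V (curl η) = 0 := hEL η hηs hηc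
  have hE1' : a1 kStar 1 V (curl η') = 0 := hEL η' hη's hη'c
  have hcub : ∀ s : ℝ, 0 < s → s ≤ s₀ → s ^ 2 * a2 kStar 1 V (curl η) + s ^ 3 * a3 (curl η) ≤ 0 := by
    intro s hs hs1
    have h := hmax θ (s • curl η) hθ (hadm s hs hs1)
    rw [locGain_smul hVs hφs hφc s, hE1, mul_zero, zero_add] at h
    exact h
  have ha2 : a2 kStar 1 V (curl η) ≤ 0 := coeff2_nonpos hs₀ hcub
  have hKpos : 0 < Kg χ V := Kg_pos hVs hχ hχc hr hχ1 hy
  rw [hE1', zero_add] at hb1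
  obtain ⟨l1, u1⟩ := abs_le.mp hb1
  obtain ⟨l2, u2⟩ := abs_le.mp hb2
  linarith

namespace Sig

/-- L4e · EULER–LAGRANGE ACROSS A THIN CONTACT SET (M; M/L in Lean).  For a field of the limit class whose contact set
`K = {‖V‖ = 1}` has empty interior, the first variation of `F̃` vanishes on the CURL OF EVERY smooth compactly supported
potential (REV 3.0: potentials, not fields — the clash only ever tests curls, so no `H²_c(ℝ³) = 0` is needed).  Route: off
`K`, two-sided strict tests `±t·curl η` and the cubic structure give `a₁(curl η) = 0` for `η` supported off `K`
(`firstSecondOrder_of_strict`, PROVED); writing `a₁(curl η) = ∫⟪G_V, η⟫` with the CONTINUOUS density `G_V = curl E_V` (two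
integrations by parts, `KStar.exists_density` pattern, dominated by `‖DʲV‖ ≤ A_j`) gives `G_V = 0` on the dense open `Kᶜ`
(`interior K = ∅`), hence everywhere, hence `a₁(curl η) = 0` for every `η`.  PROVED in REV 3.0: `eulerLagrange_holds`
(§3d; the density is the tree's `KStar.exists_density`). -/
def EulerLagrange : Prop :=
  ∀ (A : ℕ → ℝ) (A_E : ℝ) (V : E3 → E3), InLimitClass A A_E V → interior {x : E3 | ‖V x‖ = 1} = ∅ →
    ∀ η : E3 → E3, ContDiff ℝ (⊤ : ℕ∞) η → HasCompactSupport η → a1 kStar 1 V (curl η) = 0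

/-- L4t · AMPLITUDE TESTS FROM BOUNDED NEAR-TOP COMPONENTS (L−; the geometric half of the heart).  In the limit class with
bounded near-top components (L5) and a thin contact set, every centre of non-zero vorticity carries `HasAmplitudeTests`.
Route (card §L4): doubling-regular radius `r` in every window (`‖DʲV‖ ≤ A_j`); blob-respecting cut-off `χ` with a thin
shell of width `w = r^{7/8}`, flat-tailed profile, locally constant on near-top components (possible since they have
diameter `≤ D ≪ w`; components meeting the outer edge get `χ = 0` nearby, so `tsupport φ` avoids `K` where `χ = 0`);
linear-growth gauge `ψ` (`curl ψ = V` on `B_{2r}`, `|ψ| = O(√A_E · log r)`), potentials `η = −χψ`, `η' = −χ²ψ`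
(`curl η = −(χV + ∇χ×ψ)`, `curl η' = −(χ²V + ∇(χ²)×ψ)`); all error terms carry `∇χ` or a derivative of `ζ` and are `O((polylog r / w)·bulk(B_{2r})) + o(1)
≤ δ·K_{χ²}` at a doubling-regular radius.  Why it might fail: the admissibility margin on near-top components of
intermediate height (handled by local constancy of `χ`, which is exactly what L5 buys).  STRENGTH (critic V105b P1): modulo the PROVED
L4e this Prop is KERNEL-EQUIVALENT to `HomogeneityClash` (`amplitudeTests_iff_homogeneityClash`, §3e) — a certificate form of the heart. -/
def AmplitudeTests : Prop :=
  ∀ (A : ℕ → ℝ) (A_E : ℝ) (V : E3 → E3), InLimitClass A A_E V →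
    (∃ η₀ : ℝ, 0 < η₀ ∧ ∀ η' : ℝ, 0 < η' → η' ≤ η₀ → ∃ D : ℝ, NearTopBounded V η' D) →
    interior {x : E3 | ‖V x‖ = 1} = ∅ → ∀ y : E3, curl V y ≠ 0 → HasAmplitudeTests V y

/-- L4t′ · AMPLITUDE TESTS BY LOCAL RECIRCULATION THROUGH DENSE SLACK (L; the PRIMARY leaf since REV 3.1 — no near-top
geometry, replaces L4t ∧ L5).  In the limit class with a thin contact set every centre of non-zero vorticity carries
`HasAmplitudeTests` — WITHOUT bounded near-top components.  Route (card §Transverse corrector, REV 3.1): doubling-regular radius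
`r`, shell width `w = r^{7/8}`, radial profile `χ = g²` (flat-tailed), linear-growth gauge `ψ` (`curl ψ = V` on `B_{2r}`,
`|ψ| = O(√A_E·log r)`), potentials `η = −(χψ + Σ cells)`, `η′ = −χ²ψ`; so `curl η = −(χV + ∇χ×ψ + Σ curl cellᵢ)`.  ADMISSIBILITY in
the robust class: (i) where `‖V‖ ≤ 1 − 3ϑ` (SLACK) any direction is admissible for amplitudes `s ≤ s₀` (REV 3.1: `s₀` small is
allowed by the interface); (ii) on near-top points the main term `−χV` is INWARD and the gauge corrector `∇χ×ψ` is tangential and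
tiny (`≲ log r/w`), so the test is inward wherever `χ ≳ ϑ|∇χ×ψ|`; (iii) in the remaining outer sliver of the shell each near-top
structure crossing it receives a RECIRCULATION CELL: a compactly supported divergence-free loop running BACKWARD (speed-reducing,
always admissible) along `V` inside the structure, turning where `χ` dominates, and returning through ADJACENT SLACK — which
exists within distance `D(A_E, ϑ)` of every point by `slack_dense` (PROVED, §2c: near-top structures have in-radius `< D ≪ w`);
cell strength `≲ ϑ·D/w`, so all cell errors are `o(K_{χ²})`.  Remaining error terms carry `∇χ` and are
`O((polylog r / w)·bulk(B_{2r})) ≤ δ·K_{χ²}` at a doubling-regular radius (bulk includes `∫‖V‖²`, linear by `HasLinearGrowth`).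
Cells live at the FIXED scale `ℓ = cϑ/A₁` (across which `V̂` turns by `≤ ϑ/2`, so the backward cone is coherent), hence their
geometry factors are `r`-independent and their total error is `O(r^{1−7/4} log² r) = o(K_{χ²})`.  Why it might fail: (a) ESCAPE —
from every near-top point a path with tangent in the backward cone `⟪V,u⟫ ≤ −ϑ‖u‖` (half-angle `arccos ϑ`: sideways motion is
almost free, `isTestIn_smul_of_cone`) must reach `{‖V‖ ≤ 1 − 1.25ϑ}` within a length `L(ϑ, A, A_E)`; a TRAPPING near-top region
would carry `V` as an outward normal on its whole boundary, have in-radius `< D` (`slack_dense`) and boundary area bounded by flux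
pigeonhole, contradicting `div V = 0` (no-trap lemma, sketched in the card; uniformity in space by compactness of translates —
C^k_loc limits keep div-free, Lipschitz and linear growth, which is all the lemma uses); (b) bookkeeping: finitely many cells by
compactness of `shell ∩ {‖V‖ ≥ 1 − ϑ}`, smooth loop fields, error summation, the doubling-regular radius.  STRENGTH (critic V105b
P1): modulo the PROVED L4e this Prop is KERNEL-EQUIVALENT to the parent node `LimitLiouville`
(`amplitudeTestsTransverse_iff_limitLiouville`, §3e) — it is the heart in certificate (attack) form, not a lemma below it. -/
def AmplitudeTestsTransverse : Prop :=
  ∀ (A : ℕ → ℝ) (A_E : ℝ) (V : E3 → E3), InLimitClass A A_E V →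
    interior {x : E3 | ‖V x‖ = 1} = ∅ → ∀ y : E3, curl V y ≠ 0 → HasAmplitudeTests V y

end Sig

/-- **THE CLASH (PROVED).**  Euler–Lagrange + amplitude tests ⇒ the homogeneity clash L4 (`clash_core` at a centre of
non-zero vorticity). -/
theorem homogeneityClash_of (hE : Sig.EulerLagrange) (hT : Sig.AmplitudeTests) : Sig.HomogeneityClash := by
  intro A A_E V hV hN hK y
  by_contra hy
  exact hy (clash_core hV.2.1 hV.2.2.2.2.2.2 (fun η hη hηc => hE A A_E V hV hK η hη hηc) (hT A A_E V hV hN hK y hy))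

end Heart

/-! ## §3c Two-sided tests off the contact set (REV 2.1): the easy half of L4e, and the dim clash — PROVED

If `‖V‖ < 1` on `tsupport φ` then `t•φ` is a strict test for all small `|t|` (both signs), so `IsLocMax` and the cubic structure
give `a₁(φ) = 0` AND `a₂(φ) ≤ 0`.  Consequences: Euler–Lagrange holds outright for DIM fields (`‖V‖ < 1` everywhere) — which are
therefore genuine second-order local maxima along every direction — and the clash needs only `HasAmplitudeTests` there
(`curl_eq_zero_of_dim`).  What remains of L4e is exactly the density argument across a thin contact set. -/

section OffContact

open Summit.NavierStokesRegularity.NavierStokesRegularity.Theorems.DepletionLadder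

variable {κ μ : ℝ} {V φ : E3 → E3}

/-- If `t·p + t²·q + t³·w ≤ 0` for all `t ∈ (0, t₀]` then `p ≤ 0`. [folklore] -/
theorem coeff1_nonpos {p q w t₀ : ℝ} (ht₀ : 0 < t₀)
    (h : ∀ t : ℝ, 0 < t → t ≤ t₀ → t * p + t ^ 2 * q + t ^ 3 * w ≤ 0) : p ≤ 0 := by
  by_contra hp
  push Not at hp
  set S : ℝ := |q| + |w| + 1 with hS
  have hS0 : 0 < S := by positivity
  set t : ℝ := min t₀ (min 1 (p / (2 * S))) with ht
  have htpos : 0 < t := lt_min ht₀ (lt_min one_pos (div_pos hp (by positivity)))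
  have ht1 : t ≤ t₀ := min_le_left _ _
  have ht2 : t ≤ 1 := (min_le_right _ _).trans (min_le_left _ _)
  have ht3 : t ≤ p / (2 * S) := (min_le_right _ _).trans (min_le_right _ _)
  have hq : -(t ^ 2 * |q|) ≤ t ^ 2 * q := by nlinarith [neg_abs_le q, sq_nonneg t]
  have hw : -(t ^ 2 * |w|) ≤ t ^ 3 * w := by
    have h3 : t ^ 3 ≤ t ^ 2 := by nlinarith [sq_nonneg t, htpos.le]
    have : -(t ^ 3 * |w|) ≤ t ^ 3 * w := by nlinarith [neg_abs_le w, pow_pos htpos 3]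
    nlinarith [abs_nonneg w]
  have hmain : t * (|q| + |w|) ≤ p / 2 := by
    have hfrac : (|q| + |w|) / S ≤ 1 := by rw [div_le_one hS0]; linarith
    calc t * (|q| + |w|) ≤ p / (2 * S) * (|q| + |w|) := by gcongr
      _ = (p / 2) * ((|q| + |w|) / S) := by field_simp
      _ ≤ (p / 2) * 1 := by gcongr
      _ = p / 2 := mul_one _
  have hpos : 0 < t * p + t ^ 2 * q + t ^ 3 * w := by nlinarith [htpos, hq, hw, hmain]
  linarith [h t htpos ht1]

/-- If `t²·p + t³·q ≤ 0` for all `t ∈ (0, t₀]` then `p ≤ 0`. [folklore] -/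
theorem coeff2_nonpos' {p q t₀ : ℝ} (ht₀ : 0 < t₀)
    (h : ∀ t : ℝ, 0 < t → t ≤ t₀ → t ^ 2 * p + t ^ 3 * q ≤ 0) : p ≤ 0 := by
  refine coeff1_nonpos (q := q) (w := 0) ht₀ fun t ht ht' => ?_
  have h1 := h t ht ht'
  have h2 : t * (t * p + t ^ 2 * q + t ^ 3 * 0) ≤ t * 0 := by nlinarith [h1]
  exact le_of_mul_le_mul_left h2 ht

/-- `t • φ` is divergence free when `φ` is. [folklore] -/
theorem isDivFree_const_smul (hφ : ContDiff ℝ (⊤ : ℕ∞) φ) (hφdiv : VectorCalculus.IsDivFree φ) (t : ℝ) :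
    VectorCalculus.IsDivFree (t • φ) := by
  intro x
  have hφd : Differentiable ℝ φ := hφ.differentiable (by simp)
  have h0 : VectorCalculus.IsDivFree (fun _ : E3 => (0 : E3)) := by
    intro y; simp [VectorCalculus.divergence]
  have e : t • φ = fun y => (fun _ : E3 => (0 : E3)) y + t • φ y := by funext y; simp
  rw [e, KStar.divergence_add_smul (differentiable_const _) hφd t x, h0 x, hφdiv x]; ring

/-- **SMALL-AMPLITUDE ADMISSIBILITY CRITERION (PROVED, REV 3.1; the pointwise design target of L4t′).**  A smooth compactly
supported divergence-free direction `φ` with `s₀‖φ‖ ≤ θ` everywhere, which at every point EITHER sits in slack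
(`‖V‖ ≤ 1 − 2θ`: any direction allowed) OR lies in the backward cone `⟪V, φ⟫ ≤ −θ‖φ‖` (speed-reducing to first order; a
sideways component up to `≈ 2/θ` times the backward one is tolerated), gives robust tests `s•φ` of margin `θ` for ALL
amplitudes `s ∈ (0, s₀]`.  This is why recirculation cells may turn almost freely inside near-top structures and be large
(`≤ θ/s₀`) inside slack. [folklore] -/
theorem isTestIn_smul_of_cone {θ s₀ : ℝ} (hφ : ContDiff ℝ (⊤ : ℕ∞) φ) (hφc : HasCompactSupport φ)
    (hφdiv : VectorCalculus.IsDivFree φ) (hsmall : ∀ x, s₀ * ‖φ x‖ ≤ θ)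
    (hpt : ∀ x, ‖V x‖ ≤ 1 - 2 * θ ∨ ⟪V x, φ x⟫_ℝ ≤ -(θ * ‖φ x‖)) :
    ∀ s : ℝ, 0 < s → s ≤ s₀ → IsTestIn V θ (s • φ) := by
  intro s hs hs1
  refine ⟨hφ.const_smul s, HasCompactSupport.intro hφc fun x hx => by simp [image_eq_zero_of_notMem_tsupport hx],
    isDivFree_const_smul hφ hφdiv s, fun x => ?_⟩
  have hφ0 : 0 ≤ ‖φ x‖ := norm_nonneg _
  have hsφ : s * ‖φ x‖ ≤ θ := le_trans (mul_le_mul_of_nonneg_right hs1 hφ0) (hsmall x)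
  have hns : ‖(s • φ) x‖ = s * ‖φ x‖ := by rw [Pi.smul_apply, norm_smul, Real.norm_eq_abs, abs_of_pos hs]
  rcases hpt x with h1 | h2
  · left
    calc ‖V x + (s • φ) x‖ ≤ ‖V x‖ + ‖(s • φ) x‖ := norm_add_le _ _
      _ ≤ 1 - θ := by rw [hns]; linarith
  · right
    have hin : ⟪V x, (s • φ) x⟫_ℝ = s * ⟪V x, φ x⟫_ℝ := by rw [Pi.smul_apply, inner_smul_right]
    rw [hns, hin]
    have e1 : (s * ‖φ x‖) ^ 2 ≤ s * (θ * ‖φ x‖) := by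
      have hsφ0 : 0 ≤ s * ‖φ x‖ := mul_nonneg hs.le hφ0
      calc (s * ‖φ x‖) ^ 2 = (s * ‖φ x‖) * (s * ‖φ x‖) := sq _
        _ ≤ (s * ‖φ x‖) * θ := mul_le_mul_of_nonneg_left hsφ hsφ0
        _ = s * (θ * ‖φ x‖) := by ring
    have e2 : s * ⟪V x, φ x⟫_ℝ ≤ -(s * (θ * ‖φ x‖)) := by nlinarith [h2, hs]
    nlinarith [e1, e2]

/-- STRICT SUPPORT ⇒ TWO-SIDED TESTS: if `‖V‖ < 1` on `tsupport φ`, then `t•φ` is a strict admissible test for all `|t| ≤ t₀`.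
[folklore] -/
theorem isTest_smul_of_strict (hV : ContDiff ℝ (⊤ : ℕ∞) V) (hφ : ContDiff ℝ (⊤ : ℕ∞) φ) (hφc : HasCompactSupport φ)
    (hφdiv : VectorCalculus.IsDivFree φ) (hstrict : ∀ x ∈ tsupport φ, ‖V x‖ < 1) :
    ∃ t₀ : ℝ, 0 < t₀ ∧ ∀ t : ℝ, |t| ≤ t₀ → IsTest V (t • φ) := by
  -- a uniform margin `m < 1` on the compact support
  have hm : ∃ m : ℝ, m < 1 ∧ ∀ x ∈ tsupport φ, ‖V x‖ ≤ m := by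
    by_cases hne : (tsupport φ).Nonempty
    · obtain ⟨x₀, hx₀, hmax⟩ := hφc.exists_isMaxOn hne (hV.continuous.norm.continuousOn)
      exact ⟨‖V x₀‖, hstrict x₀ hx₀, fun x hx => hmax hx⟩
    · exact ⟨0, one_pos, fun x hx => (hne ⟨x, hx⟩).elim⟩
  obtain ⟨m, hm1, hmb⟩ := hm
  obtain ⟨C, hC⟩ := hφ.continuous.bounded_above_of_compact_support hφc
  set C' : ℝ := |C| + 1 with hC'
  have hC'0 : 0 < C' := by positivity
  have hCb : ∀ x, ‖φ x‖ ≤ C' := fun x => (hC x).trans ((le_abs_self C).trans (by linarith))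
  refine ⟨(1 - m) / (2 * C'), div_pos (by linarith) (by positivity), fun t ht => ?_⟩
  refine ⟨hφ.const_smul t, ?_, isDivFree_const_smul hφ hφdiv t, fun x hx => ?_⟩
  · exact HasCompactSupport.intro hφc fun x hx => by simp [image_eq_zero_of_notMem_tsupport hx]
  · have hx' : x ∈ tsupport φ := tsupport_smul_subset_right (fun _ : E3 => t) φ hx
    have h1 : ‖V x + (t • φ) x‖ ≤ ‖V x‖ + |t| * ‖φ x‖ := by
      calc ‖V x + (t • φ) x‖ ≤ ‖V x‖ + ‖(t • φ) x‖ := norm_add_le _ _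
        _ = ‖V x‖ + |t| * ‖φ x‖ := by rw [Pi.smul_apply, norm_smul, Real.norm_eq_abs]
    have h2 : |t| * ‖φ x‖ ≤ (1 - m) / (2 * C') * C' := by gcongr; exact hCb x
    have h3 : (1 - m) / (2 * C') * C' = (1 - m) / 2 := by field_simp
    linarith [hmb x hx']

/-- Every strict test is a robust test (margin = its strictness margin on the compact `tsupport φ`), so a robust local
maximiser is a local maximiser in the strict sense. [folklore] -/
theorem isLocMax_of_isLocMaxIn (hV : ContDiff ℝ (⊤ : ℕ∞) V) (h : IsLocMaxIn κ μ V) : IsLocMax κ μ V := by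
  intro φ hφ
  obtain ⟨hφs, hφc, hφdiv, hstrict⟩ := hφ
  have hm : ∃ m : ℝ, m < 1 ∧ ∀ x ∈ tsupport φ, ‖V x + φ x‖ ≤ m := by
    by_cases hne : (tsupport φ).Nonempty
    · obtain ⟨x₀, hx₀, hmax⟩ :=
        hφc.exists_isMaxOn hne ((hV.continuous.add hφs.continuous).norm.continuousOn)
      exact ⟨‖V x₀ + φ x₀‖, hstrict x₀ hx₀, fun x hx => hmax hx⟩
    · exact ⟨0, one_pos, fun x hx => (hne ⟨x, hx⟩).elim⟩
  obtain ⟨m, hm1, hmb⟩ := hm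
  refine h (1 - m) φ (by linarith) ⟨hφs, hφc, hφdiv, fun x => ?_⟩
  by_cases hx : x ∈ tsupport φ
  · exact Or.inl (by linarith [hmb x hx])
  · exact Or.inr (by simp [image_eq_zero_of_notMem_tsupport hx])

/-- **FIRST AND SECOND ORDER OFF THE CONTACT SET (PROVED).**  A local maximiser is critical (`a₁ = 0`) and second-order maximal
(`a₂ ≤ 0`) along every smooth compactly supported divergence-free direction supported where `‖V‖ < 1`. -/
theorem firstSecondOrder_of_strict (hV : ContDiff ℝ (⊤ : ℕ∞) V) (hmax : IsLocMax κ μ V) (hφ : ContDiff ℝ (⊤ : ℕ∞) φ)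
    (hφc : HasCompactSupport φ) (hφdiv : VectorCalculus.IsDivFree φ) (hstrict : ∀ x ∈ tsupport φ, ‖V x‖ < 1) :
    a1 κ μ V φ = 0 ∧ a2 κ μ V φ ≤ 0 := by
  obtain ⟨t₀, ht₀, htest⟩ := isTest_smul_of_strict hV hφ hφc hφdiv hstrict
  have hle : ∀ t : ℝ, |t| ≤ t₀ → t * a1 κ μ V φ + t ^ 2 * a2 κ μ V φ + t ^ 3 * a3 φ ≤ 0 := fun t ht => by
    have h := hmax (t • φ) (htest t ht)
    rwa [locGain_smul hV hφ hφc t] at h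
  have h1 : a1 κ μ V φ ≤ 0 :=
    coeff1_nonpos ht₀ fun t ht ht' => hle t (by rwa [abs_of_pos ht])
  have h1' : -a1 κ μ V φ ≤ 0 := by
    refine coeff1_nonpos (q := a2 κ μ V φ) (w := -a3 φ) ht₀ fun t ht ht' => ?_
    have h := hle (-t) (by rwa [abs_neg, abs_of_pos ht])
    nlinarith [h]
  have ha1 : a1 κ μ V φ = 0 := by linarith
  refine ⟨ha1, coeff2_nonpos' (q := a3 φ) ht₀ fun t ht ht' => ?_⟩
  have h := hle t (by rwa [abs_of_pos ht])
  rw [ha1, mul_zero, zero_add] at h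
  exact h

/-- **EULER–LAGRANGE FOR DIM FIELDS (PROVED).**  If `‖V‖ < 1` everywhere, L4e's conclusion holds outright (and more: `a₂ ≤ 0` in
every direction — a dim local maximiser is a genuine two-sided second-order maximum). -/
theorem eulerLagrange_dim (hV : ContDiff ℝ (⊤ : ℕ∞) V) (hmax : IsLocMax κ μ V) (hdim : ∀ x, ‖V x‖ < 1) (φ : E3 → E3)
    (hφ : ContDiff ℝ (⊤ : ℕ∞) φ) (hφc : HasCompactSupport φ) (hφdiv : VectorCalculus.IsDivFree φ) :
    a1 κ μ V φ = 0 ∧ a2 κ μ V φ ≤ 0 :=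
  firstSecondOrder_of_strict hV hmax hφ hφc hφdiv fun x _ => hdim x

/-- **THE DIM LIOUVILLE STEP (PROVED modulo the tests).**  A smooth dim (`‖V‖ < 1`) local maximiser of `F̃` with amplitude tests at
`y` has `curl V y = 0` — no Euler–Lagrange stub, no near-top geometry (critic V105 N2's «cheap first case»). -/
theorem curl_eq_zero_of_dim {V : E3 → E3} {y : E3} (hVs : ContDiff ℝ (⊤ : ℕ∞) V) (hmax : IsLocMaxIn kStar 1 V)
    (hdim : ∀ x, ‖V x‖ < 1) (hT : HasAmplitudeTests V y) : curl V y = 0 :=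
  clash_core hVs hmax
    (fun η hη hηc => (eulerLagrange_dim hVs (isLocMax_of_isLocMaxIn hVs hmax) hdim (curl η) (contDiff_curl_top hη)
      (hasCompactSupport_curl hηc) (isDivFree_curl hη)).1) hT

/-- **SECOND ROUTE TO THE PARENT NODE (PROVED composition, REV 3.0).**  Euler–Lagrange + transverse amplitude tests ⇒
`LimitLiouville`, with no near-top hypothesis (L5 moot on this route). -/
theorem limitLiouville_of_transverse (hE : Sig.EulerLagrange) (hT : Sig.AmplitudeTestsTransverse) : Sig.LimitLiouville := by
  intro A A_E V hV hK y
  by_contra hy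
  exact hy (clash_core hV.2.1 hV.2.2.2.2.2.2 (fun η hη hηc => hE A A_E V hV hK η hη hηc) (hT A A_E V hV hK y hy))

end OffContact

/-! ## §3d  L4e PROVED: Euler–Lagrange across a thin contact set (REV 3.0)

The tree's continuous density of the first-variation functional on curls (`KStar.exists_density`, where the
`C^∞`-smoothness of the limit enters) turns the off-contact identity `firstSecondOrder_of_strict` into the full
Euler–Lagrange identity on curls: the density vanishes on the dense open set `{‖V‖ < 1}` (fundamental lemma of the
calculus of variations, `IsOpen.ae_eq_zero_of_integral_contDiff_smul_eq_zero`), hence everywhere by continuity. -/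

section EulerLagrangeProof

open Summit.NavierStokesRegularity.NavierStokesRegularity.Theorems.DepletionLadder

variable {V : E3 → E3}

/-- `a₁ = ∫c₁ − (κ/μ)∫z₁ − κμ∫w₁` on a smooth compactly supported direction. [folklore] -/
theorem a1_eq_split {κ μ : ℝ} (hV : ContDiff ℝ (⊤ : ℕ∞) V) {φ : E3 → E3} (hφ : ContDiff ℝ (⊤ : ℕ∞) φ)
    (hφc : HasCompactSupport φ) :
    a1 κ μ V φ = 1 * (∫ x, c1 V φ x) + -(κ * μ⁻¹) * (∫ x, z1 V φ x) + -(κ * μ) * (∫ x, w1 V φ x) := by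
  have ic1 : Integrable (fun x => c1 V φ x) := (KStar.integrable_stretching_coeffs hV hφ hφc).1
  have iz1 : Integrable (fun x => κ * μ⁻¹ * z1 V φ x) := (KStar.integrable_enstrophy_coeffs hV hφ hφc).1.const_mul _
  have iw1 : Integrable (fun x => κ * μ * w1 V φ x) := (KStar.integrable_palinstrophy_coeffs hV hφ hφc).1.const_mul _
  have i12 : Integrable (fun x => c1 V φ x - κ * μ⁻¹ * z1 V φ x) := ic1.sub iz1
  have hpt : (fun x => c1 V φ x - (κ / 2) * (μ⁻¹ * (2 * z1 V φ x) + μ * (2 * w1 V φ x))) =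
      fun x => c1 V φ x - κ * μ⁻¹ * z1 V φ x - κ * μ * w1 V φ x := by
    funext x; ring
  unfold a1
  rw [hpt, integral_sub i12 iw1, integral_sub ic1 iz1, integral_const_mul, integral_const_mul]
  ring

/-- **L4e — `Sig.EulerLagrange` PROVED (REV 3.0).** -/
theorem eulerLagrange_holds : Sig.EulerLagrange := by
  intro A A_E V hV hK η hη hηc
  have hVs : ContDiff ℝ (⊤ : ℕ∞) V := hV.2.1
  have hle : ∀ x, ‖V x‖ ≤ 1 := hV.2.2.2.1
  have hmax : IsLocMax kStar 1 V := isLocMax_of_isLocMaxIn hVs hV.2.2.2.2.2.2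
  -- the off-contact set `U = {‖V‖ < 1}` is open and dense
  have hUo : IsOpen {x : E3 | ‖V x‖ < 1} := isOpen_lt (continuous_norm.comp hVs.continuous) continuous_const
  have hUeq : ({x : E3 | ‖V x‖ = 1})ᶜ = {x : E3 | ‖V x‖ < 1} := by
    ext x
    simp only [mem_compl_iff, mem_setOf_eq]
    exact ⟨fun h => lt_of_le_of_ne (hle x) h, fun h => ne_of_lt h⟩
  have hne : Dense {x : E3 | ‖V x‖ < 1} := by
    rw [← hUeq, ← interior_eq_empty_iff_dense_compl]
    exact hK
  -- the continuous density of `a₁ ∘ curl`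
  obtain ⟨G, hGc, hG⟩ := KStar.exists_density hVs 1 (-(kStar * (1 : ℝ)⁻¹)) (-(kStar * 1))
  have hrep : ∀ η : E3 → E3, ContDiff ℝ (⊤ : ℕ∞) η → HasCompactSupport η →
      a1 kStar 1 V (curl η) = ∫ x, ⟪G x, η x⟫_ℝ := by
    intro η hη hηc
    rw [a1_eq_split hVs (contDiff_curl_top hη) (hasCompactSupport_curl hηc), ← hG η hη hηc]
    rfl
  have hℓ0 : ∀ η : E3 → E3, ContDiff ℝ (⊤ : ℕ∞) η → HasCompactSupport η →
      tsupport η ⊆ {x : E3 | ‖V x‖ < 1} → ∫ x, ⟪G x, η x⟫_ℝ = 0 := by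
    intro η hη hηc hηU
    rw [← hrep η hη hηc]
    exact (firstSecondOrder_of_strict hVs hmax (contDiff_curl_top hη) (hasCompactSupport_curl hηc)
      (isDivFree_curl hη) (fun x hx => hηU (tsupport_curl_subset η hx))).1
  -- `G = 0` a.e. on `U` (fundamental lemma), hence on `U`, hence everywhere by density and continuity
  have hGae : ∀ᵐ x ∂(volume : Measure E3), x ∈ {x : E3 | ‖V x‖ < 1} → G x = 0 := by
    refine hUo.ae_eq_zero_of_integral_contDiff_smul_eq_zero (hGc.locallyIntegrable.locallyIntegrableOn _)
      fun θ hθ hθc hθU => ?_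
    have hint : Integrable (fun x => θ x • G x) (volume : Measure E3) :=
      (hθ.continuous.smul hGc).integrable_of_hasCompactSupport hθc.smul_right
    refine ext_inner_left ℝ fun e => ?_
    rw [inner_zero_right, ← integral_inner hint e]
    have hη : ContDiff ℝ ∞ fun x => θ x • e := hθ.smul contDiff_const
    have hηc : HasCompactSupport fun x => θ x • e := hθc.smul_right
    have hηU : tsupport (fun x => θ x • e) ⊆ {x : E3 | ‖V x‖ < 1} := (tsupport_smul_subset_left _ _).trans hθU
    have hpt : ∀ x, ⟪e, θ x • G x⟫_ℝ = ⟪G x, θ x • e⟫_ℝ := fun x => by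
      rw [inner_smul_right, inner_smul_right, real_inner_comm]
    rw [integral_congr_ae (Eventually.of_forall hpt)]
    exact hℓ0 _ hη hηc hηU
  have hGU : EqOn G 0 {x : E3 | ‖V x‖ < 1} :=
    Measure.eqOn_open_of_ae_eq ((ae_restrict_iff' hUo.measurableSet).2 hGae) hUo hGc.continuousOn
      continuousOn_const
  have hG0 : G = 0 := Continuous.ext_on hne hGc continuous_const hGU
  rw [hrep η hη hηc, hG0]
  simp

end EulerLagrangeProof

/-! ## §3e  CERTIFICATE FORMS (critic V105b, price P1 — paid in the kernel, REV 3.1)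

With L4e a THEOREM (`eulerLagrange_holds`), the amplitude leaves are no longer weakenings of the Liouville statements but their
CERTIFICATE FORMS: `AmplitudeTestsTransverse ⇔ LimitLiouville` and `AmplitudeTests ⇔ HomogeneityClash` in the kernel (forward =
the clash; converse VACUOUS — the Liouville conclusion `∀ y, curl V y = 0` empties the hypothesis `curl V y ≠ 0`).  So L4t′ IS the
heart `LimitLiouville` («an analytic robust local maximiser of `F̃` with linear energy growth and thin contact set is curl-free») in
an ATTACK FORMAT — construct `δ`-accurate robust amplitude tests at a doubling-regular radius — not a lemma strictly below it; a
director must staff it as the heart.  The reduction in strength of this line is L1–L3 + L4e (⟨26567⟩ ⇒ the limit class), not L4t′. -/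

/-- **L4t′ ⇔ the parent node** (modulo the proved Euler–Lagrange identity): certificate form of `LimitLiouville`. -/
theorem amplitudeTestsTransverse_iff_limitLiouville : Sig.AmplitudeTestsTransverse ↔ Sig.LimitLiouville :=
  ⟨fun hT => limitLiouville_of_transverse eulerLagrange_holds hT,
   fun hL A A_E V hV hK y hy => absurd (hL A A_E V hV hK y) hy⟩

/-- **L4t ⇔ the heart L4** (modulo the proved Euler–Lagrange identity): certificate form of `HomogeneityClash`. -/
theorem amplitudeTests_iff_homogeneityClash : Sig.AmplitudeTests ↔ Sig.HomogeneityClash :=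
  ⟨fun hT => homogeneityClash_of eulerLagrange_holds hT,
   fun hC A A_E V hV hN hK y hy => absurd (hC A A_E V hV hN hK y) hy⟩

/-! ## §3g  PLATEAU CALCULUS (PROVED, REV 3.2): the main terms of the amplitude tests are EXACT on the plateau

For a direction `φ` that equals `−V` on an open set `P` where the weight `χ` equals `1`, the first and second Taylor
coefficient DENSITIES of the local gain are exactly `−(3·sd − κ⋆(zd + wd))` and `3·sd − (κ⋆/2)(zd + wd)` on `P` (cubic /
quadratic homogeneity of the three densities under `V ↦ (1−s)V`, read off by matching the cubic polynomial of `gi_smul`), so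
the two defects `a₁(φ') + (3J_{χ²} − 2K_{χ²})` and `a₂(φ) − (3J_{χ²} − K_{χ²})` of `HasAmplitudeTests` are integrals over the
LAYER `Pᶜ` only (`a1_layer`, `a2_layer`).  This is the algebraic half of `CellsGivenEscape`: the whole `δ·K_{χ²}` error budget
is spent in the transition layer (cut-off gradients, the gauge corrector, the recirculation cells), never on the plateau. -/

section Plateau

open Summit.NavierStokesRegularity.NavierStokesRegularity.Theorems.DepletionLadder

variable {V φ : E3 → E3}

/-- cubic homogeneity of the stretching density. [folklore] -/
theorem sd_const_smul (hV : ContDiff ℝ (⊤ : ℕ∞) V) (c : ℝ) (x : E3) :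
    sd (fun y => c • V y) x = c ^ 3 * sd V x := by
  have hVd : Differentiable ℝ V := hV.differentiable (by simp)
  unfold sd
  rw [curl_const_smul (hVd x), fderiv_fun_const_smul (hVd x)]
  simp only [smul_apply, map_smul, real_inner_smul_left, real_inner_smul_right]
  ring

/-- quadratic homogeneity of the enstrophy density. [folklore] -/
theorem zd_const_smul (hV : ContDiff ℝ (⊤ : ℕ∞) V) (c : ℝ) (x : E3) :
    zd (fun y => c • V y) x = c ^ 2 * zd V x := by
  have hVd : Differentiable ℝ V := hV.differentiable (by simp)
  unfold zd
  rw [curl_const_smul (hVd x), norm_smul, mul_pow, Real.norm_eq_abs, sq_abs]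

/-- quadratic homogeneity of the palinstrophy density. [folklore] -/
theorem wd_const_smul (hV : ContDiff ℝ (⊤ : ℕ∞) V) (c : ℝ) (x : E3) :
    wd (fun y => c • V y) x = c ^ 2 * wd V x := by
  have hVd : Differentiable ℝ V := hV.differentiable (by simp)
  have hcV : ContDiff ℝ 1 (curl V) := contDiff_curl (n := 1) (hV.of_le (by norm_cast))
  have hcd : Differentiable ℝ (curl V) := hcV.differentiable (by norm_num)
  have hfun : curl (fun y => c • V y) = fun y => c • curl V y := funext fun y => curl_const_smul (hVd y) c
  unfold wd
  rw [hfun, fderiv_fun_const_smul (hcd x)]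
  simp only [frobeniusNormSq, smul_apply, norm_smul, mul_pow, Real.norm_eq_abs, sq_abs,
    Finset.mul_sum]

/-- The gain integrand along the pure amplitude direction `−V`: an explicit cubic in `s`. [folklore] -/
theorem gi_smul_neg (hV : ContDiff ℝ (⊤ : ℕ∞) V) (κ μ s : ℝ) (x : E3) :
    gi κ μ V (s • fun y => -V y) x =
      ((1 - s) ^ 3 - 1) * sd V x - (κ / 2) * (μ⁻¹ * (((1 - s) ^ 2 - 1) * zd V x) + μ * (((1 - s) ^ 2 - 1) * wd V x)) := by
  have hW : (V + s • fun y => -V y) = fun y => (1 - s) • V y := by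
    funext y
    simp only [Pi.add_apply, Pi.smul_apply, smul_neg, sub_smul, one_smul]
    abel
  unfold gi
  rw [hW, sd_const_smul hV, zd_const_smul hV, wd_const_smul hV]
  ring

/-- Matching a cubic through the origin at `s = 1, −1, 2` determines its first two coefficients. -/
theorem coeff_match {A B C A' B' C' : ℝ}
    (h : ∀ s : ℝ, s * A + s ^ 2 * B + s ^ 3 * C = s * A' + s ^ 2 * B' + s ^ 3 * C') : A = A' ∧ B = B' := by
  have h1 := h 1; have h2 := h (-1); have h3 := h 2
  constructor <;> nlinarith [h1, h2, h3]

/-- **FIRST- AND SECOND-ORDER DENSITIES ON THE PLATEAU.**  If `φ` agrees with `−V` near `x`, the first Taylor coefficient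
density of the gain is `−3·sd + κ(μ⁻¹ zd + μ wd)` and the second is `3·sd − (κ/2)(μ⁻¹ zd + μ wd)` at `x`. [folklore] -/
theorem plateau_densities (hV : ContDiff ℝ (⊤ : ℕ∞) V) (hφ : ContDiff ℝ (⊤ : ℕ∞) φ) {κ μ : ℝ} {x : E3}
    (h : φ =ᶠ[𝓝 x] fun y => -V y) :
    c1 V φ x - (κ / 2) * (μ⁻¹ * (2 * z1 V φ x) + μ * (2 * w1 V φ x)) = -3 * sd V x + κ * (μ⁻¹ * zd V x + μ * wd V x) ∧
      c2 V φ x - (κ / 2) * (μ⁻¹ * zd φ x + μ * wd φ x) = 3 * sd V x - (κ / 2) * (μ⁻¹ * zd V x + μ * wd V x) := by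
  -- germ transfer: the gain integrand of `s•φ` at `x` equals that of `s•(−V)`
  have hgerm : ∀ s : ℝ, gi κ μ V (s • φ) x = gi κ μ V (s • fun y => -V y) x := by
    intro s
    have hs : (V + s • φ) =ᶠ[𝓝 x] (V + s • fun y => -V y) :=
      h.mono fun y hy => by simp only [Pi.add_apply, Pi.smul_apply, hy]
    unfold gi
    rw [sd_congr hs, zd_congr hs, wd_congr hs]
  have hpoly : ∀ s : ℝ,
      s * (c1 V φ x - (κ / 2) * (μ⁻¹ * (2 * z1 V φ x) + μ * (2 * w1 V φ x))) +
          s ^ 2 * (c2 V φ x - (κ / 2) * (μ⁻¹ * zd φ x + μ * wd φ x)) + s ^ 3 * c3 φ x =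
        s * (-3 * sd V x + κ * (μ⁻¹ * zd V x + μ * wd V x)) +
          s ^ 2 * (3 * sd V x - (κ / 2) * (μ⁻¹ * zd V x + μ * wd V x)) + s ^ 3 * (-sd V x) := by
    intro s
    rw [← gi_smul hV hφ s x, hgerm s, gi_smul_neg hV κ μ s x]
    ring
  exact coeff_match hpoly

variable (V φ) in
/-- the first Taylor coefficient density of the local gain with `κ = κ⋆`, `μ = 1` (the integrand of `a1 kStar 1 V φ`). -/
def f1 (x : E3) : ℝ := c1 V φ x - (kStar / 2) * ((1 : ℝ)⁻¹ * (2 * z1 V φ x) + 1 * (2 * w1 V φ x))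

variable (V φ) in
/-- the second Taylor coefficient density of the local gain with `κ = κ⋆`, `μ = 1` (the integrand of `a2 kStar 1 V φ`). -/
def f2 (x : E3) : ℝ := c2 V φ x - (kStar / 2) * ((1 : ℝ)⁻¹ * zd φ x + 1 * wd φ x)

theorem a1_eq_integral_f1 : a1 kStar 1 V φ = ∫ x, f1 V φ x := rfl
theorem a2_eq_integral_f2 : a2 kStar 1 V φ = ∫ x, f2 V φ x := rfl

/-- **FIRST-ORDER LAYER FORMULA.**  For smooth compactly supported `φ` equal to `−V` on an open set `P` on which the continuous
compactly supported weight `χ` equals `1`, the first-order defect of `HasAmplitudeTests` is an integral over the layer `Pᶜ`: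
`a₁(φ) + (3J_{χ²} − 2K_{χ²}) = ∫_{Pᶜ} (f₁ + χ²(3·sd − κ⋆(zd + wd)))`. [folklore] -/
theorem a1_layer (hV : ContDiff ℝ (⊤ : ℕ∞) V) (hφ : ContDiff ℝ (⊤ : ℕ∞) φ) (hφc : HasCompactSupport φ) {χ : E3 → ℝ}
    (hχ : Continuous χ) (hχc : HasCompactSupport χ) {P : Set E3} (hP : IsOpen P) (hχP : ∀ x ∈ P, χ x = 1)
    (hφP : ∀ x ∈ P, φ x = -V x) :
    a1 kStar 1 V φ + (3 * Jg χ V - 2 * Kg χ V) =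
      ∫ x in Pᶜ, (f1 V φ x + χ x ^ 2 * (3 * sd V x - kStar * (zd V x + wd V x))) := by
  have ic1 : Integrable (c1 V φ) := (KStar.integrable_stretching_coeffs hV hφ hφc).1
  have iz1 : Integrable (z1 V φ) := (KStar.integrable_enstrophy_coeffs hV hφ hφc).1
  have iw1 : Integrable (w1 V φ) := (KStar.integrable_palinstrophy_coeffs hV hφ hφc).1
  have if1 : Integrable (f1 V φ) :=
    ic1.sub ((((iz1.const_mul 2).const_mul (1 : ℝ)⁻¹).add ((iw1.const_mul 2).const_mul 1)).const_mul (kStar / 2))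
  -- the weighted bulk densities are continuous with compact support
  have hg_cont : Continuous fun x => χ x ^ 2 * (3 * sd V x - kStar * (zd V x + wd V x)) :=
    (hχ.pow 2).mul ((continuous_const.mul (continuous_sd hV)).sub
      (continuous_const.mul ((continuous_zd hV).add (continuous_wd hV))))
  have hg_supp : HasCompactSupport fun x => χ x ^ 2 * (3 * sd V x - kStar * (zd V x + wd V x)) := by
    refine HasCompactSupport.intro hχc fun x hx => ?_
    simp [image_eq_zero_of_notMem_tsupport hx]
  have ig : Integrable fun x => χ x ^ 2 * (3 * sd V x - kStar * (zd V x + wd V x)) :=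
    hg_cont.integrable_of_hasCompactSupport hg_supp
  have hJ_cont : Continuous fun x => χ x ^ 2 * sd V x := (hχ.pow 2).mul (continuous_sd hV)
  have hJ_supp : HasCompactSupport fun x => χ x ^ 2 * sd V x := by
    refine HasCompactSupport.intro hχc fun x hx => ?_
    simp [image_eq_zero_of_notMem_tsupport hx]
  have iJ : Integrable fun x => χ x ^ 2 * sd V x := hJ_cont.integrable_of_hasCompactSupport hJ_supp
  have hK_cont : Continuous fun x => χ x ^ 2 * (zd V x + wd V x) := (hχ.pow 2).mul ((continuous_zd hV).add (continuous_wd hV))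
  have hK_supp : HasCompactSupport fun x => χ x ^ 2 * (zd V x + wd V x) := by
    refine HasCompactSupport.intro hχc fun x hx => ?_
    simp [image_eq_zero_of_notMem_tsupport hx]
  have iK : Integrable fun x => χ x ^ 2 * (zd V x + wd V x) := hK_cont.integrable_of_hasCompactSupport hK_supp
  -- pointwise: the combined integrand vanishes on the plateau
  have hzero : ∀ x, x ∉ Pᶜ → f1 V φ x + χ x ^ 2 * (3 * sd V x - kStar * (zd V x + wd V x)) = 0 := by
    intro x hx
    have hxP : x ∈ P := not_notMem.1 hx
    have hgerm : φ =ᶠ[𝓝 x] fun y => -V y :=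
      Filter.eventually_of_mem (hP.mem_nhds hxP) fun y hy => hφP y hy
    have h1 := (plateau_densities hV hφ (κ := kStar) (μ := 1) hgerm).1
    unfold f1
    rw [h1, hχP x hxP]
    ring
  rw [setIntegral_eq_integral_of_forall_compl_eq_zero hzero, integral_add if1 ig]
  have eg : (fun x => χ x ^ 2 * (3 * sd V x - kStar * (zd V x + wd V x))) =
      fun x => 3 * (χ x ^ 2 * sd V x) - kStar * (χ x ^ 2 * (zd V x + wd V x)) := by
    funext x; ring
  rw [eg, integral_sub (iJ.const_mul 3) (iK.const_mul kStar), integral_const_mul, integral_const_mul]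
  unfold Jg Kg
  rw [a1_eq_integral_f1]
  ring

/-- **SECOND-ORDER LAYER FORMULA.**  Same setting: `a₂(φ) − (3J_{χ²} − K_{χ²}) = ∫_{Pᶜ} (f₂ − χ²(3·sd − (κ⋆/2)(zd + wd)))`.
[folklore] -/
theorem a2_layer (hV : ContDiff ℝ (⊤ : ℕ∞) V) (hφ : ContDiff ℝ (⊤ : ℕ∞) φ) (hφc : HasCompactSupport φ) {χ : E3 → ℝ}
    (hχ : Continuous χ) (hχc : HasCompactSupport χ) {P : Set E3} (hP : IsOpen P) (hχP : ∀ x ∈ P, χ x = 1)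
    (hφP : ∀ x ∈ P, φ x = -V x) :
    a2 kStar 1 V φ - (3 * Jg χ V - Kg χ V) =
      ∫ x in Pᶜ, (f2 V φ x - χ x ^ 2 * (3 * sd V x - kStar / 2 * (zd V x + wd V x))) := by
  have ic2 : Integrable (c2 V φ) := (KStar.integrable_stretching_coeffs hV hφ hφc).2.1
  have izd : Integrable (zd φ) := (KStar.integrable_enstrophy_coeffs hV hφ hφc).2
  have iwd : Integrable (wd φ) := (KStar.integrable_palinstrophy_coeffs hV hφ hφc).2
  have if2 : Integrable (f2 V φ) :=
    ic2.sub (((izd.const_mul (1 : ℝ)⁻¹).add (iwd.const_mul 1)).const_mul (kStar / 2))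
  have hg_cont : Continuous fun x => χ x ^ 2 * (3 * sd V x - kStar / 2 * (zd V x + wd V x)) :=
    (hχ.pow 2).mul ((continuous_const.mul (continuous_sd hV)).sub
      (continuous_const.mul ((continuous_zd hV).add (continuous_wd hV))))
  have hg_supp : HasCompactSupport fun x => χ x ^ 2 * (3 * sd V x - kStar / 2 * (zd V x + wd V x)) := by
    refine HasCompactSupport.intro hχc fun x hx => ?_
    simp [image_eq_zero_of_notMem_tsupport hx]
  have ig : Integrable fun x => χ x ^ 2 * (3 * sd V x - kStar / 2 * (zd V x + wd V x)) :=
    hg_cont.integrable_of_hasCompactSupport hg_supp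
  have hJ_cont : Continuous fun x => χ x ^ 2 * sd V x := (hχ.pow 2).mul (continuous_sd hV)
  have hJ_supp : HasCompactSupport fun x => χ x ^ 2 * sd V x := by
    refine HasCompactSupport.intro hχc fun x hx => ?_
    simp [image_eq_zero_of_notMem_tsupport hx]
  have iJ : Integrable fun x => χ x ^ 2 * sd V x := hJ_cont.integrable_of_hasCompactSupport hJ_supp
  have hK_cont : Continuous fun x => χ x ^ 2 * (zd V x + wd V x) := (hχ.pow 2).mul ((continuous_zd hV).add (continuous_wd hV))
  have hK_supp : HasCompactSupport fun x => χ x ^ 2 * (zd V x + wd V x) := by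
    refine HasCompactSupport.intro hχc fun x hx => ?_
    simp [image_eq_zero_of_notMem_tsupport hx]
  have iK : Integrable fun x => χ x ^ 2 * (zd V x + wd V x) := hK_cont.integrable_of_hasCompactSupport hK_supp
  have hzero : ∀ x, x ∉ Pᶜ → f2 V φ x - χ x ^ 2 * (3 * sd V x - kStar / 2 * (zd V x + wd V x)) = 0 := by
    intro x hx
    have hxP : x ∈ P := not_notMem.1 hx
    have hgerm : φ =ᶠ[𝓝 x] fun y => -V y :=
      Filter.eventually_of_mem (hP.mem_nhds hxP) fun y hy => hφP y hy
    have h2 := (plateau_densities hV hφ (κ := kStar) (μ := 1) hgerm).2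
    unfold f2
    rw [h2, hχP x hxP]
    simp
  rw [setIntegral_eq_integral_of_forall_compl_eq_zero hzero, integral_sub if2 ig]
  have eg : (fun x => χ x ^ 2 * (3 * sd V x - kStar / 2 * (zd V x + wd V x))) =
      fun x => 3 * (χ x ^ 2 * sd V x) - kStar / 2 * (χ x ^ 2 * (zd V x + wd V x)) := by
    funext x; ring
  rw [eg, integral_sub (iJ.const_mul 3) (iK.const_mul (kStar / 2)), integral_const_mul, integral_const_mul]
  unfold Jg Kg
  rw [a2_eq_integral_f2]

end Plateau

/-! ## §3f  THE RESIDUAL OF ROUTE TWO, TYPED (REV 3.2a): no backward-cone traps (`Escape`) + cells given escape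

Route two (L4t′) = recirculation cells through the dense slack (§2c).  Its only non-constructive input is KINEMATIC and is typed
here as its own leaf so that it can be proved — or refuted — independently of the variational heart:

* `Sig.Escape` (L4t′-E, size M): a smooth divergence-free field with `‖V‖ ≤ 1`, bounded derivatives and LINEAR ENERGY GROWTH has
  no backward-cone traps — from every point of height `≥ 1 − θ` (`0 < θ ≤ 1/4`) a `C¹` path with velocity in the closed backward
  cone `⟪V(γ), γ′⟫ ≤ −θ‖γ′‖` (half-angle `arccos θ ≥ 75°` around `−V`; stopping allowed) and length `≤ L(θ, A, A_E)` reaches the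
  slack `{‖V‖ ≤ 1 − 2θ}`.  WHY TRUE (sketch, card §Transverse corrector): if no path from `p` escapes, the reachable set `Ω` lies in
  `{‖V‖ > 1 − 2θ}`, every proximal outward normal of `∂Ω` lies in the polar cone = within angle `arcsin θ ≤ 14.5°` of `V̂`, so
  `⟪V, n⟫ ≥ (1 − 2θ)√(1 − θ²) > 0` on `∂Ω`; `Ω` has in-radius `< D(A_E, 2θ)` (`slack_dense`) and `|Ω ∩ B_R| ≤ A_E R / (1 − 2θ)²`,
  flux pigeonhole over radii bounds `Area(∂Ω ∩ B_R)` uniformly, whence `|Ω| < ∞`, and along radii `R_k` with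
  `Area(Ω ∩ ∂B_{R_k}) → 0` the divergence theorem gives `0 = ∮ ⟪V, n⟫ ≥ c · Per(Ω; B_{R_k}) − o(1)`, i.e. `Per Ω = 0` — impossible
  for a non-empty open set of finite volume.  Uniformity of `L` by compactness of translates in `C^k_loc` (the class is closed
  under such limits; run the trap argument at `θ̃ = θ + ε` to absorb margins).  The cone condition forces `γ′ = 0` where
  `‖V‖ < θ`, which never matters: the target level `1 − 2θ ≥ 1/2 > θ`.  WHY IT MIGHT FAIL: a divergence-free linear-growth field
  with a near-top region whose boundary normal stays within `14.5°` of `V̂` on a set of directions defeating every wide backward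
  cone (the flux computation says no; jets, column arrays, dipole channels and helical tubes all escape sideways within `O(w)`).
* `Sig.CellsGivenEscape` (L4t′-C, size L — THE HEART given escape): the construction of `δ`-accurate ROBUST amplitude tests at
  a doubling-regular radius from `InLimitClass` + `HasEscape` + thin contact (`isTestIn_smul_of_cone`, `slack_dense`, the
  gauge `ψ`, recirculation cells of scale `ℓ = cθ/A₁`; ERROR BUDGET as in the `CellsGivenEscape` docstring / card §Error budget —
  L²-only estimates at a two-scale doubling radius for the companion, cells entering only the SECOND coefficient at cost `O(r ε_r²) → 0`).
  KERNEL STATUS: `CellsGivenEscape ⇔ AmplitudeTestsTransverse ⇔ LimitLiouville` modulo `Escape` + the proved L4e — still the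
  heart in certificate form; what the split buys is that the prover of the heart may ASSUME escape, and a refuter may attack
  escape alone.

Composition `amplitudeTestsTransverse_of : Escape → CellsGivenEscape → AmplitudeTestsTransverse` (logic only). -/

/-- An ESCAPE PATH for `V` with cone parameter `θ`, length budget `L`, from `p`: a `C¹` curve on `[0,1]` starting at `p`, velocity
in the closed `θ`-backward cone of `V` (so `isTestIn_smul_of_cone`'s pointwise alternative holds along it; `γ′ = 0` allowed),
length `≤ L`, ending in the slack `{‖V‖ ≤ 1 − 2θ}`. -/
def IsEscapePath (V : E3 → E3) (θ L : ℝ) (p : E3) (γ : ℝ → E3) : Prop :=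
  ContDiff ℝ 1 γ ∧ γ 0 = p ∧ (∀ t ∈ Set.Icc (0 : ℝ) 1, ⟪V (γ t), deriv γ t⟫_ℝ ≤ -(θ * ‖deriv γ t‖)) ∧
    (∫ t in (0 : ℝ)..1, ‖deriv γ t‖) ≤ L ∧ ‖V (γ 1)‖ ≤ 1 - 2 * θ

/-- `V` HAS ESCAPE: for every cone parameter `θ ∈ (0, 1/4]` a UNIFORM length `L` such that from every point of height `≥ 1 − θ`
some `θ`-backward-cone path of length `≤ L` reaches `{‖V‖ ≤ 1 − 2θ}`. -/
def HasEscape (V : E3 → E3) : Prop :=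
  ∀ θ : ℝ, 0 < θ → θ ≤ 1 / 4 → ∃ L : ℝ, 0 < L ∧ ∀ p : E3, 1 - θ ≤ ‖V p‖ → ∃ γ : ℝ → E3, IsEscapePath V θ L p γ

/-- **STRAIGHT ESCAPE SEGMENTS (PROVED; the building block of escape paths and of the fatness of reachable sets).**  The affine path
`t ↦ x + (ρ t)•d` (`‖d‖ = 1`, `ρ ≥ 0`) is an escape path as soon as the cone condition `⟪V, d⟫ ≤ −θ` holds along the segment and its
endpoint is slack; with `norm_sub_le_of_budget` the cone condition along the segment follows from `⟪V x, d⟫ ≤ −(θ + A 1 · ρ)` at the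
base point alone (`isEscapePath_segment_of_base`). -/
theorem isEscapePath_segment {V : E3 → E3} {θ ρ : ℝ} (hρ : 0 ≤ ρ) (x d : E3) (hd : ‖d‖ = 1)
    (hcone : ∀ t ∈ Set.Icc (0 : ℝ) 1, ⟪V (x + (ρ * t) • d), d⟫_ℝ ≤ -θ) (hend : ‖V (x + ρ • d)‖ ≤ 1 - 2 * θ) :
    IsEscapePath V θ ρ x (fun t => x + (ρ * t) • d) := by
  have hderiv : ∀ t, deriv (fun t : ℝ => x + (ρ * t) • d) t = ρ • d := by
    intro t
    have h1 : HasDerivAt (fun t : ℝ => ρ * t) ρ t := by simpa using (hasDerivAt_id t).const_mul ρ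
    have h2 : HasDerivAt (fun t : ℝ => x + (ρ * t) • d) (ρ • d) t := by
      simpa using (h1.smul_const d).const_add x
    exact h2.deriv
  refine ⟨?_, by simp, ?_, ?_, by simpa using hend⟩
  · exact contDiff_const.add ((contDiff_const.mul contDiff_id).smul contDiff_const)
  · intro t ht
    rw [hderiv, real_inner_smul_right, norm_smul, Real.norm_eq_abs, abs_of_nonneg hρ, hd, mul_one]
    have := hcone t ht
    nlinarith [this, hρ]
  · simp only [hderiv, norm_smul, Real.norm_eq_abs, abs_of_nonneg hρ, hd, mul_one, intervalIntegral.integral_const,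
      sub_zero, smul_eq_mul, one_mul, le_refl]

/-- Base-point version: the cone condition at `x` with margin `A 1 · ρ` propagates along the whole segment by the Lipschitz bound. -/
theorem isEscapePath_segment_of_base {A : ℕ → ℝ} {V : E3 → E3} (hV : ContDiff ℝ (⊤ : ℕ∞) V)
    (hA : ∀ (j : ℕ) (x : E3), ‖iteratedFDeriv ℝ j V x‖ ≤ A j) {θ ρ : ℝ} (hρ : 0 ≤ ρ) (x d : E3) (hd : ‖d‖ = 1)
    (hbase : ⟪V x, d⟫_ℝ ≤ -(θ + A 1 * ρ)) (hend : ‖V (x + ρ • d)‖ ≤ 1 - 2 * θ) :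
    IsEscapePath V θ ρ x (fun t => x + (ρ * t) • d) := by
  refine isEscapePath_segment hρ x d hd (fun t ht => ?_) hend
  have hlip := norm_sub_le_of_budget hV hA x (x + (ρ * t) • d)
  have hdist : ‖x + (ρ * t) • d - x‖ = ρ * t := by
    rw [add_sub_cancel_left, norm_smul, Real.norm_eq_abs, hd, mul_one, abs_of_nonneg (mul_nonneg hρ ht.1)]
  rw [hdist] at hlip
  have hA1 : 0 ≤ A 1 := le_trans (norm_nonneg _) (hA 1 0)
  have hcs : ⟪V (x + (ρ * t) • d) - V x, d⟫_ℝ ≤ ‖V (x + (ρ * t) • d) - V x‖ * ‖d‖ := real_inner_le_norm _ _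
  rw [hd, mul_one] at hcs
  have hsplit : ⟪V (x + (ρ * t) • d), d⟫_ℝ = ⟪V x, d⟫_ℝ + ⟪V (x + (ρ * t) • d) - V x, d⟫_ℝ := by
    rw [← inner_add_left]; congr 1; abel
  rw [hsplit]
  have ht1 : ρ * t ≤ ρ := by nlinarith [ht.2]
  nlinarith [hlip, hcs, hbase, mul_le_mul_of_nonneg_left ht1 hA1]

/-- **GROWTH IS LOAD-BEARING IN `Escape` (PROVED negative brick, `Escape_false_without_growth` style).**  A CONSTANT field of unit
length — smooth, divergence free, `‖V‖ ≤ 1`, every derivative budget — has NO escape: every path ends at height `1 > 1 − 2θ`.  So any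
proof of `Sig.Escape` must use `HasLinearGrowth` (which constants violate: energy `≍ R³`). -/
theorem not_hasEscape_const {v₀ : E3} (hv : ‖v₀‖ = 1) : ¬ HasEscape (fun _ : E3 => v₀) := by
  intro h
  obtain ⟨L, -, hL⟩ := h (1 / 4) (by norm_num) le_rfl
  obtain ⟨γ, hγ⟩ := hL 0 (by rw [hv]; norm_num)
  have hend := hγ.2.2.2.2
  rw [hv] at hend
  norm_num at hend

/-- **PURE AMPLITUDE REDUCTION IS ROBUSTLY ADMISSIBLE (PROVED; pointwise clause of `IsTestIn` for `φ = −g•V`, `0 ≤ g ≤ 1`).**  At every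
point either the slack alternative (where `‖V‖ < θ`) or the inward-cone alternative (where `‖V‖ ≥ θ`) holds for `s•φ`, `0 < s ≤ 1`,
`0 < θ ≤ 1/2` — the plateau part `−χ²V` of the amplitude tests and the corrector-free trouble regions of the cell construction need no
slack at all. -/
theorem amplitude_clause {V : E3 → E3} {g : E3 → ℝ} {s θ : ℝ} (hs0 : 0 < s) (hs1 : s ≤ 1) (hθ0 : 0 < θ) (hθ1 : θ ≤ 1 / 2)
    (hg0 : ∀ x, 0 ≤ g x) (hg1 : ∀ x, g x ≤ 1) (hV1 : ∀ x, ‖V x‖ ≤ 1) (x : E3) :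
    ‖V x + (s • fun y => -(g y • V y)) x‖ ≤ 1 - θ ∨
      ‖(s • fun y => -(g y • V y)) x‖ ^ 2 + 2 * ⟪V x, (s • fun y => -(g y • V y)) x⟫_ℝ ≤
        -(θ * ‖(s • fun y => -(g y • V y)) x‖) := by
  have hsg0 : 0 ≤ s * g x := mul_nonneg hs0.le (hg0 x)
  have hsg1 : s * g x ≤ 1 := by nlinarith [hg1 x, hg0 x]
  have hφ : (s • fun y => -(g y • V y)) x = (-(s * g x)) • V x := by
    simp only [Pi.smul_apply, smul_neg, smul_smul, neg_smul]
  rw [hφ]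
  by_cases hVθ : ‖V x‖ < θ
  · left
    have : V x + (-(s * g x)) • V x = (1 - s * g x) • V x := by rw [sub_smul, one_smul, neg_smul, sub_eq_add_neg]
    rw [this, norm_smul, Real.norm_eq_abs, abs_of_nonneg (by linarith)]
    nlinarith [norm_nonneg (V x)]
  · right
    push Not at hVθ
    rw [norm_smul, norm_neg, Real.norm_eq_abs, abs_of_nonneg hsg0, real_inner_smul_right, real_inner_self_eq_norm_sq]
    have hV0 : 0 ≤ ‖V x‖ := norm_nonneg _
    nlinarith [mul_nonneg hsg0 hV0, mul_le_mul_of_nonneg_left hVθ hsg0, hV1 x, mul_nonneg (mul_nonneg hsg0 hV0) hV0]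

/-- **THE BACKWARD CONE IS CONVEX (PROVED).**  Linear cone conditions add — this is how the plateau part, the corrector and the cells
are assembled pointwise (then `isTestIn_smul_of_cone`, §3c, turns the linear cone condition into the `IsTestIn` clause for small `s`). -/
theorem cone_add {V a b : E3} {θ : ℝ} (hθ : 0 ≤ θ) (ha : ⟪V, a⟫_ℝ ≤ -(θ * ‖a‖)) (hb : ⟪V, b⟫_ℝ ≤ -(θ * ‖b‖)) :
    ⟪V, a + b⟫_ℝ ≤ -(θ * ‖a + b‖) := by
  rw [inner_add_right]
  nlinarith [norm_add_le a b, mul_le_mul_of_nonneg_left (norm_add_le a b) hθ]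

namespace Sig

/-- L4t′-E · ESCAPE (NO BACKWARD-CONE TRAPS; registered by text, REV 3.2a; size M; purely kinematic — no analyticity, no
maximality).  Smooth, divergence free, `‖V‖ ≤ 1`, derivative budget `A`, linear energy growth `A_E` ⇒ `HasEscape V`.  Sketch and
`why it might fail` in the §3f docstring; cheapest falsifier: any explicit divergence-free linear-growth field with a wide-cone trap
between the levels `1 − θ` and `1 − 2θ`. -/
def Escape : Prop :=
  ∀ (A : ℕ → ℝ) (A_E : ℝ) (V : E3 → E3), ContDiff ℝ (⊤ : ℕ∞) V → VectorCalculus.IsDivFree V → (∀ x, ‖V x‖ ≤ 1) →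
    (∀ (j : ℕ) (x : E3), ‖iteratedFDeriv ℝ j V x‖ ≤ A j) → HasLinearGrowth A_E V → HasEscape V

/-- L4t′-C · CELLS GIVEN ESCAPE (registered by text, REV 3.2a; size L — the heart of route two with its kinematic input
discharged as a hypothesis): `InLimitClass A A_E V`, `HasEscape V`, thin contact set and `curl V y ≠ 0` ⇒ `HasAmplitudeTests V y`
(the recirculation-cell construction of the L4t′ docstring).  KERNEL STATUS: equivalent to `AmplitudeTestsTransverse`, hence to
`LimitLiouville`, modulo `Escape` and the proved L4e — certificate form of the heart.  ERROR BUDGET (REV 3.3, card §Error budget):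
the robust test needs only ADMISSIBILITY and its SECOND coefficient (its first is killed exactly by the proved L4e), so the recirculation
cells — amplitude `O(ε_r)`, `ε_r ≈ log r / r^{7/8}`, at most `O(A_E r)` of them — cost `O(r ε_r²) → 0` in `a₂`, whereas at first order they
would cost `O(r ε_r) → ∞`; the companion (first coefficient, no admissibility, no cells) is estimated with L² norms only (energy growth,
`‖DV‖₂ ≲ ‖curl V‖₂ + r⁻¹‖V‖₂`, Calderón–Zygmund for the potential) at a two-scale doubling-regular radius, the lower bound
`∫_{B(y,1)}(|curl V|² + |∇curl V|²) > 0` absorbing the `bulk^{1/2}` terms. -/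
def CellsGivenEscape : Prop :=
  ∀ (A : ℕ → ℝ) (A_E : ℝ) (V : E3 → E3), InLimitClass A A_E V → HasEscape V →
    interior {x : E3 | ‖V x‖ = 1} = ∅ → ∀ y : E3, curl V y ≠ 0 → HasAmplitudeTests V y

end Sig

/-- **Route two assembled from its two typed leaves** (logic only): escape + cells-given-escape ⇒ L4t′. -/
theorem amplitudeTestsTransverse_of (hE : Sig.Escape) (hC : Sig.CellsGivenEscape) : Sig.AmplitudeTestsTransverse :=
  fun A A_E V hV hK y hy =>
    hC A A_E V hV (hE A A_E V hV.2.1 hV.2.2.1 hV.2.2.2.1 hV.2.2.2.2.1 hV.2.2.2.2.2.1) hK y hy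

/-- Conversely the leaf L4t′ gives `CellsGivenEscape` outright (drop the escape hypothesis): so `CellsGivenEscape` sits between
`AmplitudeTestsTransverse` unconditionally and `AmplitudeTestsTransverse` given `Escape` — honest kernel status of the split. -/
theorem cellsGivenEscape_of_transverse (hT : Sig.AmplitudeTestsTransverse) : Sig.CellsGivenEscape :=
  fun A A_E V hV _ hK y hy => hT A A_E V hV hK y hy

/-- `CellsGivenEscape ⇔ AmplitudeTestsTransverse` modulo `Escape` (hence `⇔ LimitLiouville` modulo `Escape` + the proved L4e). -/
theorem cellsGivenEscape_iff_transverse (hE : Sig.Escape) : Sig.CellsGivenEscape ↔ Sig.AmplitudeTestsTransverse :=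
  ⟨amplitudeTestsTransverse_of hE, cellsGivenEscape_of_transverse⟩

/-- Hence escape + cells-given-escape ⇒ the parent node `LimitLiouville` (with the proved L4e). -/
theorem limitLiouville_of_escape (hE : Sig.Escape) (hC : Sig.CellsGivenEscape) : Sig.LimitLiouville :=
  limitLiouville_of_transverse eulerLagrange_holds (amplitudeTestsTransverse_of hE hC)

/-! ## §3i  THE HEART GIVEN ESCAPE, CUT IN TWO (REV 3.6): an analytic COMPANION half (size M, no cells, no admissibility) and a
ROBUST-TEST half (size L, the recirculation cells) at a common SCALE-REGULAR radius with the CANONICAL cut-off — `CellsGivenEscape`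
is DERIVED from the two (`cellsGivenEscape_of_halves`).  The cut follows the card's §Error budget: the companion `φ' = −curl(χ_r²ψ)`
needs only the L²-layer estimates (Calderón–Zygmund for `ψ`, Caccioppoli, linear energy growth) and the existence of scale-regular
radii (`exists_twoScale_radius`); the robust test needs, in addition, ESCAPE + thin contact for the cells in the sliver. -/
section Halves

/-- the unit bump profile (Mathlib): radii `1 < 2`, centre `0`. -/
def bump₁ : ContDiffBump (0 : E3) := ⟨1, 2, one_pos, one_lt_two⟩

/-- **CANONICAL CUT-OFF** `χ_r(x) = bump₁(r⁻¹(x − y))`: smooth, `= 1` on `B(y,r)`, `= 0` off `B(y,2r)`, values in `[0,1]`;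
`‖Dᵏχ_r‖_∞ = r⁻ᵏ‖Dᵏbump₁‖_∞` by scaling (the quantitative layer bounds of the error budget). -/
def cut (y : E3) (r : ℝ) (x : E3) : ℝ := bump₁ (r⁻¹ • (x - y))

theorem cut_eq_one {y : E3} {r : ℝ} (hr : 0 < r) {x : E3} (hx : x ∈ Metric.ball y r) : cut y r x = 1 := by
  unfold cut
  apply bump₁.one_of_mem_closedBall
  rw [Metric.mem_closedBall, dist_zero_right, norm_smul, norm_inv, Real.norm_eq_abs, abs_of_pos hr]
  rw [Metric.mem_ball, dist_eq_norm] at hx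
  show r⁻¹ * ‖x - y‖ ≤ 1
  rw [inv_mul_le_iff₀ hr]
  linarith

theorem cut_eq_zero {y : E3} {r : ℝ} (hr : 0 < r) {x : E3} (hx : 2 * r ≤ dist x y) : cut y r x = 0 := by
  unfold cut
  apply bump₁.zero_of_le_dist
  rw [dist_zero_right, norm_smul, norm_inv, Real.norm_eq_abs, abs_of_pos hr]
  show (2 : ℝ) ≤ r⁻¹ * ‖x - y‖
  rw [dist_eq_norm] at hx
  rw [le_inv_mul_iff₀ hr]
  linarith

theorem cut_nonneg (y : E3) (r : ℝ) (x : E3) : 0 ≤ cut y r x := bump₁.nonneg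

theorem cut_le_one (y : E3) (r : ℝ) (x : E3) : cut y r x ≤ 1 := bump₁.le_one

theorem contDiff_cut (y : E3) (r : ℝ) : ContDiff ℝ (⊤ : ℕ∞) (cut y r) := by
  have h : ContDiff ℝ (⊤ : ℕ∞) (fun x : E3 => r⁻¹ • (x - y)) := (contDiff_id.sub contDiff_const).const_smul r⁻¹
  exact bump₁.contDiff.comp h

theorem continuous_cut (y : E3) (r : ℝ) : Continuous (cut y r) := (contDiff_cut y r).continuous

theorem hasCompactSupport_cut (y : E3) {r : ℝ} (hr : 0 < r) : HasCompactSupport (cut y r) := by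
  apply HasCompactSupport.intro (isCompact_closedBall y (2 * r))
  intro x hx
  rw [Metric.mem_closedBall, not_le] at hx
  exact cut_eq_zero hr hx.le

/-- quadratic BULK on a ball: `∫_{B(y,R)} (|curl V|² + |∇curl V|²)`. -/
def bulk (V : E3 → E3) (y : E3) (R : ℝ) : ℝ := ∫ x in Metric.ball y R, (zd V x + wd V x)

/-- **SCALE-REGULAR radius** (generous: four doublings at factor 16): `bulk(B(y,16r)) ≤ 16⁴·bulk(B(y,r))`.  Such radii exist
beyond every threshold for limit-class fields with `curl V y ≠ 0` (`exists_twoScale_radius` with `q = 16`: cubic growth of the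
bulk from the derivative budget, positivity at `y`); they make every layer / neighbouring-scale L²-error of the budget `≲ bulk(B(y,r))`. -/
def ScaleRegular (V : E3 → E3) (y : E3) (r : ℝ) : Prop := bulk V y (16 * r) ≤ 65536 * bulk V y r

/-- the factor-16 form of `exists_twoScale_radius` (PROVED): `f(R₀) > 0`, `f(R) ≤ C R³` for `R ≥ R₀` ⇒ some `r = R₀·16ᵏ` has
`f(16r) ≤ 16⁴·f(r)`. -/
theorem exists_twoScale_radius16 {f : ℝ → ℝ} {R₀ C : ℝ} (hR₀ : 0 < R₀) (hpos : 0 < f R₀)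
    (hgrowth : ∀ R : ℝ, R₀ ≤ R → f R ≤ C * R ^ 3) : ∃ k : ℕ, f (16 * (R₀ * 16 ^ k)) ≤ 65536 * f (R₀ * 16 ^ k) := by
  obtain ⟨K, hK⟩ := pow_unbounded_of_one_lt (C * R₀ ^ 3 / f R₀) (by norm_num : (1 : ℝ) < 16)
  have hb : f (R₀ * 16 ^ K) < 65536 ^ K * f (R₀ * 16 ^ 0) := by
    rw [pow_zero, mul_one]
    have h1 : f (R₀ * 16 ^ K) ≤ C * (R₀ * 16 ^ K) ^ 3 :=
      hgrowth _ (le_mul_of_one_le_right hR₀.le (one_le_pow₀ (by norm_num)))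
    have h2 : C * R₀ ^ 3 < 16 ^ K * f R₀ := by
      have := (div_lt_iff₀ hpos).mp hK
      linarith
    have h3 : (65536 : ℝ) ^ K = 16 ^ K * (16 ^ K) ^ 3 := by
      rw [← pow_mul, ← pow_add, show (65536 : ℝ) = 16 ^ 4 by norm_num, ← pow_mul]; ring_nf
    have h4 : 0 < ((16 : ℝ) ^ K) ^ 3 := by positivity
    calc f (R₀ * 16 ^ K) ≤ C * (R₀ * 16 ^ K) ^ 3 := h1
      _ = C * R₀ ^ 3 * (16 ^ K) ^ 3 := by ring
      _ < 16 ^ K * f R₀ * (16 ^ K) ^ 3 := mul_lt_mul_of_pos_right h2 h4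
      _ = 65536 ^ K * f R₀ := by rw [h3]; ring
  obtain ⟨k, -, hk⟩ := exists_step_ratio_le (b := fun k => f (R₀ * 16 ^ k)) (by norm_num : (0 : ℝ) ≤ 65536) hb
  refine ⟨k, ?_⟩
  have : R₀ * 16 ^ (k + 1) = 16 * (R₀ * 16 ^ k) := by ring
  simpa [this] using hk

/-- pointwise bound of the quadratic densities from the derivative budget (PROVED; `norm_curl_le`, `norm_fderiv_curl_le`). -/
theorem zd_add_wd_le {A : ℕ → ℝ} {V : E3 → E3} (hV : ContDiff ℝ (⊤ : ℕ∞) V)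
    (hA : ∀ (j : ℕ) (x : E3), ‖iteratedFDeriv ℝ j V x‖ ≤ A j) (x : E3) :
    zd V x + wd V x ≤ ‖curlCLM‖ ^ 2 * (A 1 ^ 2 + 3 * A 2 ^ 2) := by
  have hK : 0 ≤ ‖curlCLM‖ := ContinuousLinearMap.opNorm_nonneg _
  have hD : ‖fderiv ℝ V x‖ ≤ A 1 := by rw [← norm_iteratedFDeriv_one]; exact hA 1 x
  have hω : ‖curl V x‖ ≤ ‖curlCLM‖ * A 1 := (norm_curl_le V x).trans (mul_le_mul_of_nonneg_left hD hK)
  have hDω : ‖fderiv ℝ (curl V) x‖ ≤ ‖curlCLM‖ * A 2 :=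
    (norm_fderiv_curl_le (hV.of_le (by norm_cast)) x).trans (mul_le_mul_of_nonneg_left (hA 2 x) hK)
  have h1 : zd V x ≤ (‖curlCLM‖ * A 1) ^ 2 := by
    unfold zd; exact pow_le_pow_left₀ (norm_nonneg _) hω 2
  have h2 : wd V x ≤ 3 * (‖curlCLM‖ * A 2) ^ 2 := by
    unfold wd
    calc frobeniusNormSq (fderiv ℝ (curl V) x) ≤ 3 * ‖fderiv ℝ (curl V) x‖ ^ 2 := frobeniusNormSq_le_three_mul _
      _ ≤ 3 * (‖curlCLM‖ * A 2) ^ 2 := by gcongr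
  calc zd V x + wd V x ≤ (‖curlCLM‖ * A 1) ^ 2 + 3 * (‖curlCLM‖ * A 2) ^ 2 := add_le_add h1 h2
    _ = ‖curlCLM‖ ^ 2 * (A 1 ^ 2 + 3 * A 2 ^ 2) := by ring

/-- CUBIC GROWTH OF THE BULK from the derivative budget (PROVED). -/
theorem bulk_le_of_budget {A : ℕ → ℝ} {V : E3 → E3} (hV : ContDiff ℝ (⊤ : ℕ∞) V)
    (hA : ∀ (j : ℕ) (x : E3), ‖iteratedFDeriv ℝ j V x‖ ≤ A j) (y : E3) {R : ℝ} (hR : 0 < R) :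
    bulk V y R ≤ ‖curlCLM‖ ^ 2 * (A 1 ^ 2 + 3 * A 2 ^ 2) * (volume (Metric.ball (0 : E3) 1)).toReal * R ^ 3 := by
  set c : ℝ := ‖curlCLM‖ ^ 2 * (A 1 ^ 2 + 3 * A 2 ^ 2) with hc
  have hpt : ∀ x, zd V x + wd V x ≤ c := fun x => zd_add_wd_le hV hA x
  have hcont : Continuous fun x => zd V x + wd V x := (continuous_zd hV).add (continuous_wd hV)
  have hint : IntegrableOn (fun x => zd V x + wd V x) (Metric.ball y R) volume :=
    (hcont.continuousOn.integrableOn_compact (isCompact_closedBall y R)).mono_set Metric.ball_subset_closedBall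
  unfold bulk
  calc ∫ x in Metric.ball y R, (zd V x + wd V x) ≤ ∫ x in Metric.ball y R, c :=
        setIntegral_mono_on hint (integrableOn_const measure_ball_lt_top.ne) measurableSet_ball fun x hx => hpt x
    _ = c * (volume (Metric.ball (0 : E3) 1)).toReal * R ^ 3 := by
        rw [setIntegral_const, smul_eq_mul, measureReal_def, volume_ball_toReal y hR]; ring

/-- POSITIVITY OF THE BULK at a point of non-zero curl (PROVED). -/
theorem bulk_pos {V : E3 → E3} (hV : ContDiff ℝ (⊤ : ℕ∞) V) {y : E3} (hy : curl V y ≠ 0) {R : ℝ} (hR : 0 < R) :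
    0 < bulk V y R := by
  have hcont : Continuous fun x => zd V x + wd V x := (continuous_zd hV).add (continuous_wd hV)
  have hint : IntegrableOn (fun x => zd V x + wd V x) (Metric.ball y R) volume :=
    (hcont.continuousOn.integrableOn_compact (isCompact_closedBall y R)).mono_set Metric.ball_subset_closedBall
  have hnn : 0 ≤ᵐ[volume.restrict (Metric.ball y R)] fun x => zd V x + wd V x :=
    Filter.Eventually.of_forall fun x => by
      have h1' : 0 ≤ zd V x := by unfold zd; positivity
      have h2' : 0 ≤ wd V x := frobeniusNormSq_nonneg _
      show 0 ≤ zd V x + wd V x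
      positivity
  unfold bulk
  rw [setIntegral_pos_iff_support_of_nonneg_ae hnn hint]
  have hcurl : Continuous (curl V) := continuous_curl (hV.of_le (by norm_cast))
  have hev : ∀ᶠ x in 𝓝 y, curl V x ≠ 0 := hcurl.continuousAt.eventually_ne hy
  obtain ⟨ρ, hρ, hρball⟩ := Metric.eventually_nhds_iff.1 hev
  have hsub : Metric.ball y (min ρ R) ⊆ (Function.support fun x => zd V x + wd V x) ∩ Metric.ball y R := by
    intro x hx
    have hxρ : dist x y < ρ := lt_of_lt_of_le (Metric.mem_ball.1 hx) (min_le_left _ _)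
    have hxr : x ∈ Metric.ball y R := Metric.mem_ball.2 (lt_of_lt_of_le (Metric.mem_ball.1 hx) (min_le_right _ _))
    have hne : curl V x ≠ 0 := hρball hxρ
    have hzd : 0 < zd V x := by unfold zd; positivity
    have hwd : 0 ≤ wd V x := frobeniusNormSq_nonneg _
    refine ⟨?_, hxr⟩
    rw [Function.mem_support]
    exact ne_of_gt (by positivity)
  exact lt_of_lt_of_le (Metric.measure_ball_pos volume y (lt_min hρ hR)) (measure_mono hsub)

/-- **SCALE-REGULAR RADII EXIST beyond every threshold (PROVED)** for limit-class fields at a point of non-zero curl — the radius half of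
`Sig.CompanionHalf` is discharged; what remains there is the L² layer budget. -/
theorem exists_scaleRegular {A : ℕ → ℝ} {A_E : ℝ} {V : E3 → E3} (hV : InLimitClass A A_E V) {y : E3} (hy : curl V y ≠ 0)
    {r₀ : ℝ} (hr₀ : 0 < r₀) : ∃ r : ℝ, r₀ ≤ r ∧ ScaleRegular V y r := by
  have hgrowth : ∀ R : ℝ, r₀ ≤ R →
      bulk V y R ≤ ‖curlCLM‖ ^ 2 * (A 1 ^ 2 + 3 * A 2 ^ 2) * (volume (Metric.ball (0 : E3) 1)).toReal * R ^ 3 :=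
    fun R hR => bulk_le_of_budget hV.2.1 hV.2.2.2.2.1 y (lt_of_lt_of_le hr₀ hR)
  obtain ⟨k, hk⟩ := exists_twoScale_radius16 hr₀ (bulk_pos hV.2.1 hy hr₀) hgrowth
  exact ⟨r₀ * 16 ^ k, le_mul_of_one_le_right hr₀.le (one_le_pow₀ (by norm_num)), hk⟩

namespace Sig

/-- **HALF 1 — COMPANION (support→crux, size M; pure analysis, no cells, no admissibility).**  For a limit-class field with
`curl V y ≠ 0` and every `δ > 0`: beyond every threshold there is a SCALE-REGULAR radius `r` and a compactly supported smooth
`η'` whose curl reproduces the first variation of the quadratic part at the canonical cut-off to relative accuracy `δ`: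
`|a₁(curl η') + (3J − 2K)| ≤ δK` (`J = Jg (cut y r) V`, `K = Kg (cut y r) V`).  Blueprint: `η' = −(cut y r)²·ψ`, `ψ` the
Biot–Savart potential of `χ̃V`; `a₁(−curl(χ²ψ)) = −(3J − 2K) + layer`, layer `= O(r^{-1/2}K^{1/2} + r⁻¹K) = o(K)` at scale-regular
radii by the §Error budget (L² norms only).  WHY IT MIGHT FAIL: only through a mis-set exponent in the layer budget — the
statement has no geometric content; it is the M-sized analytic debt of route two. -/
def CompanionHalf : Prop :=
  ∀ (A : ℕ → ℝ) (A_E : ℝ) (V : E3 → E3), InLimitClass A A_E V → ∀ y : E3, curl V y ≠ 0 →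
    ∀ δ : ℝ, 0 < δ → ∀ r₀ : ℝ, 0 < r₀ → ∃ r : ℝ, r₀ ≤ r ∧ ScaleRegular V y r ∧
      ∃ η' : E3 → E3, ContDiff ℝ (⊤ : ℕ∞) η' ∧ HasCompactSupport η' ∧
        |a1 kStar 1 V (curl η') + (3 * Jg (cut y r) V - 2 * Kg (cut y r) V)| ≤ δ * Kg (cut y r) V

/-- **HALF 2 — ROBUST TEST (crux, size L; the recirculation cells).**  For a limit-class field with ESCAPE and thin contact,
`curl V y ≠ 0`, and every `δ > 0`: at every sufficiently large SCALE-REGULAR radius `r` there is a ROBUSTLY ADMISSIBLE amplitude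
test `s·curl η` (`IsTestIn V θ (s • curl η)` for all `0 < s ≤ s₀`) with `|a₂(curl η) − (3J − K)| ≤ δK` at the canonical cut-off.
Blueprint (card §3f/§Error budget): `curl η = −(cut y r)²V − ∇(cut y r)² × ψ + c_r + (cells)`, the corrector `c_r` killing `a₁`
exactly (L4e, proved) and the cells re-routing the sliver flux backwards along escape paths (`Sig.Escape`) across the transverse
part of the contact set; cost `O(r ε_r²)→0` in `a₂`.  WHY IT MIGHT FAIL: the cell construction in the sliver is the one piece of
new mathematics of the line — a contact set meeting the layer in a set of large capacity could force cells too expensive in `a₂`. -/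
def RobustHalf : Prop :=
  ∀ (A : ℕ → ℝ) (A_E : ℝ) (V : E3 → E3), InLimitClass A A_E V → HasEscape V → interior {x : E3 | ‖V x‖ = 1} = ∅ →
    ∀ y : E3, curl V y ≠ 0 → ∀ δ : ℝ, 0 < δ → ∃ r₀ : ℝ, 0 < r₀ ∧ ∀ r : ℝ, r₀ ≤ r → ScaleRegular V y r →
      ∃ (θ s₀ : ℝ) (η : E3 → E3), 0 < θ ∧ 0 < s₀ ∧ ContDiff ℝ (⊤ : ℕ∞) η ∧ HasCompactSupport η ∧
        (∀ s : ℝ, 0 < s → s ≤ s₀ → IsTestIn V θ (s • curl η)) ∧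
        |a2 kStar 1 V (curl η) - (3 * Jg (cut y r) V - Kg (cut y r) V)| ≤ δ * Kg (cut y r) V

end Sig

/-- **CELLS GIVEN ESCAPE from the two halves (PROVED, logic + the cut-off facts).**  The robust half fixes a threshold, the
companion half supplies a scale-regular radius beyond it together with `η'`, the robust half then supplies `η` at that radius;
the canonical cut-off is the `χ` of `HasAmplitudeTests`. -/
theorem cellsGivenEscape_of_halves (hC : Sig.CompanionHalf) (hR : Sig.RobustHalf) : Sig.CellsGivenEscape := by
  intro A A_E V hV hE hK y hy δ hδ
  obtain ⟨r₂, hr₂, h2⟩ := hR A A_E V hV hE hK y hy δ hδ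
  obtain ⟨r, hr, hreg, η', hη'1, hη'2, hη'3⟩ := hC A A_E V hV y hy δ hδ r₂ hr₂
  have hr0 : 0 < r := lt_of_lt_of_le hr₂ hr
  obtain ⟨θ, s₀, η, hθ, hs₀, hη1, hη2, hη3, hη4⟩ := h2 r hr hreg
  exact ⟨r, θ, s₀, cut y r, η, η', hr0, hθ, hs₀, continuous_cut y r, hasCompactSupport_cut y hr0,
    fun x hx => cut_eq_one hr0 hx, hη1, hη2, hη3, hη'1, hη'2, hη'3, hη4⟩

end Halves

/-- L1 — CLOSED in REV 1.2 (`localSlack_holds`, §3a); kept under its stub name for the skeleton. -/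
theorem stub_localSlack : Sig.LocalSlack := localSlack_holds

/-- L2 — CLOSED BY NAME (REV 3.5): the statement is the landed text of record (`…LocalMaximiser.ThickGoodCentre`, p709662) and the proof is
ns-net-p1 g14's landed `thickGoodCentre_holds` (`Theorems/ExtremiserTransienceLocalMaximiserThickGoodCentre.lean`, p710316). -/
theorem stub_thickGoodCentre : Sig.ThickGoodCentre := thickGoodCentre_holds

/-- L3 — CLOSED BY NAME (REV 3.8): the statement is the landed text of record (`…LocalMaximiser.Extraction`,
`…LocalMaximiserLimitDefs`) and the proof is ns-net-p2 g11's landed `extraction_holds`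
(`Theorems/ExtremiserTransienceLocalMaximiserExtraction.lean`, p713234, commit f770d0937b4c). -/
theorem stub_extraction : Sig.Extraction :=
  Summit.NavierStokesRegularity.NavierStokesRegularity.Theorems.NearExtremalTransiencePerFlow.LocalMaximiser.extraction_holds

/-- L4e — CLOSED in REV 3.0: `eulerLagrange_holds` (§3d). -/
theorem stub_eulerLagrange : Sig.EulerLagrange := eulerLagrange_holds

/-- L4t (registered by text) — amplitude tests from bounded near-top components; KERNEL-EQUIVALENT to the heart L4
`HomogeneityClash` modulo the proved L4e (`amplitudeTests_iff_homogeneityClash`, §3e): a certificate form, not a weakening. -/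
theorem stub_amplitudeTests : Sig.AmplitudeTests := by
  sorry

/-- L4t′-E (registered by text, REV 3.2a) — ESCAPE: no backward-cone traps under linear energy growth (kinematic, size M). -/
theorem stub_escape : Sig.Escape := by
  sorry

/-- L4t′-C1 (registered by text, REV 3.6) — COMPANION HALF (size M; pure analysis: scale-regular radii + the L² layer budget). -/
theorem stub_companionHalf : Sig.CompanionHalf := by
  sorry

/-- L4t′-C2 (registered by text, REV 3.6) — ROBUST-TEST HALF (size L; the recirculation cells given ESCAPE + thin contact). -/
theorem stub_robustHalf : Sig.RobustHalf := by
  sorry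

/-- L4t′-C (registered by text REV 3.2a; DERIVED since REV 3.6: `cellsGivenEscape_of_halves stub_companionHalf stub_robustHalf`) —
CELLS GIVEN ESCAPE: the recirculation-cell construction of robust amplitude tests (size L; ≡ the heart modulo `Escape` + L4e).
Still claimable directly under its own text. -/
theorem stub_cellsGivenEscape : Sig.CellsGivenEscape := cellsGivenEscape_of_halves stub_companionHalf stub_robustHalf

/-- L4t′ (DERIVED since REV 3.2a: `amplitudeTestsTransverse_of stub_escape stub_cellsGivenEscape`) — PRIMARY LEAF since REV 3.1: amplitude tests by recirculation through dense slack (no near-top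
geometry; replaces L4t ∧ L5); KERNEL-EQUIVALENT to the parent node `LimitLiouville` modulo the proved L4e
(`amplitudeTestsTransverse_iff_limitLiouville`, §3e) — it IS the heart in certificate form and must be staffed as such. -/
theorem stub_amplitudeTestsTransverse : Sig.AmplitudeTestsTransverse :=
  amplitudeTestsTransverse_of stub_escape stub_cellsGivenEscape

/-- L4 — the heart, now DERIVED (REV 2.0): `homogeneityClash_of stub_eulerLagrange stub_amplitudeTests`. -/
theorem stub_homogeneityClash : Sig.HomogeneityClash := homogeneityClash_of stub_eulerLagrange stub_amplitudeTests

/-- L5 (registered by text) — the residual enemy (tubes). -/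
theorem stub_noPercolation : Sig.NoPercolation := by
  sorry

/-! ## §4 Composition: the crux BY NAME from L1–L5 (kernel-checked; no `sorry` below this line) -/

/-- L1 feeds L2: the slack hypothesis of `ThickGoodCentre` is exactly the conclusion of `LocalSlack`, so L1 + L2 give the
`Selection` consumed by L3 (both stubs are load-bearing in `NearExtremalTransiencePerFlow_of`). -/
theorem selection_of (h1 : Sig.LocalSlack) (h2 : Sig.ThickGoodCentre) : Sig.Selection := by
  intro A hA
  obtain ⟨θ₀, hθ₀, hsel⟩ := h2 A hA
  refine ⟨θ₀, hθ₀, fun R η hR hη => ?_⟩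
  obtain ⟨ε₀, hε₀, hmain⟩ := hsel R η hR hη
  exact ⟨ε₀, hε₀, fun v M B ε hadm hreg hZ hW hε hεε₀ hext =>
    hmain v M B ε hadm hreg hZ hW hε hεε₀ hext (fun k φ hφ hdisj => h1 v M B ε k φ hadm hZ hW hext hφ hdisj)⟩

/-- The limit class is empty of fields with non-zero curl (L4 + L5 + the proved plateau branch). -/
theorem limitClass_curl_eq_zero (h4 : Sig.HomogeneityClash) (h5 : Sig.NoPercolation)
    {A : ℕ → ℝ} {A_E : ℝ} {V : E3 → E3} (hV : InLimitClass A A_E V) : ∀ y : E3, curl V y = 0 := by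
  by_cases hpl : (interior {x : E3 | ‖V x‖ = 1}).Nonempty
  · exact (noPlateau_of_linearGrowth hV.1 hV.2.2.2.2.2.1 hpl).elim
  · exact h4 A A_E V hV (h5 A A_E V hV) (Set.not_nonempty_iff_eq_empty.1 hpl)

/-- The registered split of the parent node: L4 + L5 ⇒ `LimitLiouville` (REV 1.1). -/
theorem limitLiouville_of (h4 : Sig.HomogeneityClash) (h5 : Sig.NoPercolation) : Sig.LimitLiouville :=
  fun A A_E V hV hK => h4 A A_E V hV (h5 A A_E V hV) hK

/-- Composition through the PARENT node: `NearExtremalTransiencePerFlow` from L1, L2, L3 and the limit Liouville theorem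
(any proof of `LimitLiouville` — via L4+L5 or via the transverse corrector — closes the line). -/
theorem NearExtremalTransiencePerFlow_of_liouville (h1 : Sig.LocalSlack) (h2 : Sig.ThickGoodCentre)
    (h3 : Sig.Extraction) (hL : Sig.LimitLiouville) : NearExtremalTransiencePerFlow := by
  intro C ν T hC hν hT u p hsol hLH hdec hrate hsing
  by_contra hno
  have hviol : IsViolator C ν T u p := ⟨hC, hν, hT, hsol, hLH, hdec, hrate, hsing, hno⟩
  obtain ⟨A, A_E, V, hA, hAE, hV, y, hy⟩ := h3 (selection_of h1 h2) C ν T u p hviol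
  by_cases hpl : (interior {x : E3 | ‖V x‖ = 1}).Nonempty
  · exact (noPlateau_of_linearGrowth hV.1 hV.2.2.2.2.2.1 hpl).elim
  · exact hy (hL A A_E V hV (Set.not_nonempty_iff_eq_empty.1 hpl) y)

/-- **THE SKELETON.** `NearExtremalTransiencePerFlow` ⟨stmt-26567⟩ BY NAME from the five stubs: a violator would produce
(L1 → L2 → L3) an analytic local maximiser with non-zero curl, which L4/L5 and the plateau branch forbid. -/
theorem NearExtremalTransiencePerFlow_of (h1 : Sig.LocalSlack) (h2 : Sig.ThickGoodCentre) (h3 : Sig.Extraction)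
    (h4 : Sig.HomogeneityClash) (h5 : Sig.NoPercolation) : NearExtremalTransiencePerFlow := by
  intro C ν T hC hν hT u p hsol hLH hdec hrate hsing
  by_contra hno
  have hviol : IsViolator C ν T u p := ⟨hC, hν, hT, hsol, hLH, hdec, hrate, hsing, hno⟩
  obtain ⟨A, A_E, V, hA, hAE, hV, y, hy⟩ := h3 (selection_of h1 h2) C ν T u p hviol
  exact hy (limitClass_curl_eq_zero h4 h5 hV y)

/-- **THE SKELETON, REV 2.0 form**: the crux BY NAME from the OPEN stubs L2, L3, L4e, L4t, L5 (L1 is proved, the clash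
is proved). -/
theorem NearExtremalTransiencePerFlow_of2 (h2 : Sig.ThickGoodCentre) (h3 : Sig.Extraction) (h4e : Sig.EulerLagrange)
    (h4t : Sig.AmplitudeTests) (h5 : Sig.NoPercolation) : NearExtremalTransiencePerFlow :=
  NearExtremalTransiencePerFlow_of localSlack_holds h2 h3 (homogeneityClash_of h4e h4t) h5

/-- **THE SKELETON, second route (REV 3.0)**: the crux BY NAME from L2, L3, L4e and the transverse leaf L4t′ (no L5). -/
theorem NearExtremalTransiencePerFlow_of3 (h2 : Sig.ThickGoodCentre) (h3 : Sig.Extraction) (h4e : Sig.EulerLagrange)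
    (h4t' : Sig.AmplitudeTestsTransverse) : NearExtremalTransiencePerFlow :=
  NearExtremalTransiencePerFlow_of_liouville localSlack_holds h2 h3 (limitLiouville_of_transverse h4e h4t')

/-- **THE SKELETON, second route with the typed residual (REV 3.2a)**: the crux BY NAME from L2, L3, L4e, ESCAPE and
CELLS-GIVEN-ESCAPE. -/
theorem NearExtremalTransiencePerFlow_of4 (h2 : Sig.ThickGoodCentre) (h3 : Sig.Extraction) (h4e : Sig.EulerLagrange)
    (hE : Sig.Escape) (hC : Sig.CellsGivenEscape) : NearExtremalTransiencePerFlow :=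
  NearExtremalTransiencePerFlow_of3 h2 h3 h4e (amplitudeTestsTransverse_of hE hC)

/-- **THE SKELETON, second route with the heart cut in two (REV 3.6)**: the crux BY NAME from L2, L3, L4e, ESCAPE, the
COMPANION half and the ROBUST-TEST half. -/
theorem NearExtremalTransiencePerFlow_of5 (h2 : Sig.ThickGoodCentre) (h3 : Sig.Extraction) (h4e : Sig.EulerLagrange)
    (hE : Sig.Escape) (hC1 : Sig.CompanionHalf) (hC2 : Sig.RobustHalf) : NearExtremalTransiencePerFlow :=
  NearExtremalTransiencePerFlow_of4 h2 h3 h4e hE (cellsGivenEscape_of_halves hC1 hC2)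

/-- The same with the registered stubs plugged in (documentation of the dependency; contains their `sorry`s). -/
theorem NearExtremalTransiencePerFlow_skeleton : NearExtremalTransiencePerFlow :=
  NearExtremalTransiencePerFlow_of stub_localSlack stub_thickGoodCentre stub_extraction stub_homogeneityClash
    stub_noPercolation

end Summit.NavierStokesRegularity.NavierStokesRegularity.Cruxes.NearExtremalTransience.LocalMaximiser

end
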